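import Mathlib.Analysis.Calculus.MeanValue
import Literature.Analysis.FunctionSpaces.TorusAnalyticSeminorm
import Literature.Analysis.ODE.TorusTransportEstimates
import HarnessLib

/-!
# The transport (regularity-shift) estimate for the analyticity seminorms `⟦·⟧_{n,R}` — Armstrong–Vicol App. A Lemma 7.7, corrected radius, PROVED

Analysis/FunctionSpaces file (theorems only; no definitions, no named facts). Armstrong–Vicol
(*Anomalous diffusion by fractal homogenization*, Ann. PDE 11 (2025) = arXiv:2305.05048, App. A =
§7 of the arXiv version, Lemma 7.7, p. 72) state: if `(∂ₜ + f·∇)Y = g`, `Y(0) = 0`, and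
`⟦f(t)⟧_{n,R_f} ≤ C_f`, `⟦g(t)⟧_{n,R_g} ≤ C_g` for `1 ≤ n ≤ N` with `R_f ≤ R_g`, then
`⟦Y(t)⟧_{n,R_Y(t)} ≤ 8 d C_g |t|` for `|t| ≤ T = 1/(4 d C_f R_f)` with `R_Y(t) = R_g + 4|t| d C_f R_f²`.

**The printed radius is wrong when `R_g > R_f`.** In the inductive step (p. 72) the order-`n`
self-interaction term is bounded by "`(d C_f R_f n)/(4 t R_Y(t)ⁿ) ∫₀ᵗ s R_Y(s)ⁿ ds · sup ≤ (1/16) sup`";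
the exact value of that coefficient is `n (R_Y(t)^{n+1} − R_g^{n+1})/(16 (n+1) R_f R_Y(t)ⁿ)`, which is
`≈ n R_Y/(16(n+1)R_f)` and exceeds `1` as soon as `R_g ≳ 16 R_f`; and the statement itself fails
there (counterexample, `d = 1`: `f = −(a/2π) sin(2πx)` with `a = 5`, `R_f = 20`, `C_f = 1`,
`g = c cos(λx)` with `λ = 2πm ≥ N R_g`, `R_g → ∞`: `⟦Y(T)⟧_{N,R_Y(T)} → C_g (e^{N/16} − 1)/(N a)`,
which exceeds `8 C_g T` for `N ≥ 56`; cell `ad-ideate`, lit g26, FINDING L26-1, 2026-08-28).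
What IS true, with the same constants and the same proof once the coefficient is computed
correctly, is the statement with the radius

  `R_Y(t) := R_g (1 + 4 |t| d C_f R_f) = R_g + 4 |t| d C_f R_f R_g`

(the upper bound for the printed radius displayed in (e.bear.salmon.2); it COINCIDES with the
printed radius when `R_g = R_f`, which is the only case in which Armstrong–Vicol apply the lemma:
`g = −f` in Prop. 7.10). With this radius the self-interaction coefficient is
`n/(16(n+1)) · (R/R_g)(1 − (R_g/R)^{n+1}) ≤ n/(8(n+1)) < 1/8`, and the budget closes as
`C_g + (3/4)·8dC_g + (n/(n+1))·dC_g < 8 d C_g`. Cor. 7.8 (`⟦∇Y⟧` at radius `R_g(1+4|t|dC_fR_f)²`) follows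
from the corrected lemma verbatim (`TorusAnalyticComposition`,
`ArmstrongVicol2025_transportShift_grad_of_transportShift`'s argument only uses
`R_Y ≤ R_g(1 + 4|t|dC_fR_f)`), so it is discharged there from this file.

Contents (the proof follows the printed induction on `n`, pp. 72, made honest):
* §1 spatial helpers over `Torus.iterPartialDeriv` words: commutation `∂^{i::l} = ∂^{l++[i]}`,
  components, negation, and the **commutator Leibniz bound**
  `|∂^l(a ψ) − a ∂^l ψ| ≤ Σ_{k<n} C(n,k+1) derivSup (k+1) a · derivSup (n−1−k) ψ`;
* §2 the elementary weight sums `Σ_{k<K} 1/(k+2)² ≤ 1`, `Σ_{k<K} 1/(k+3)² ≤ 1/2` and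
  `Σ_{k<n−1} (n+1)²/((k+3)²(n−k)²) ≤ 3` (partial fractions);
* §3 slab calculus: `∂ₜ` commutes with `∂^l` within `[a,b]`, the transported equation for `∂^l Y`,
  the a priori time-Lipschitz bound of `∂^l Y` on the compact slab;
* §4 the inductive step = one bootstrap pass (BDSV's sup-norm transport estimate
  `Literature.Analysis.ODE.norm_le_of_transport` along characteristics with an explicit polynomial
  majorant, integrated in closed form) and the discrete continuation in time;
* §5 the theorem on the forward slab `[0,T₀]`, `T₀ ≤ T`, for a scalar transported quantity;
* §6 the packaging in the vocabulary of the fact file `TorusAnalyticComposition` (fields on all of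
  `ℝ`, pointwise `HasDerivAt` form of the equation, `|t| ≤ T`, vector `Y` componentwise; negative
  times by time reversal): `Torus.dnorm_transportShift_le` (the corrected Lemma 7.7, in exactly the binder
  shape of the named fact `Torus.ArmstrongVicol2025_transportShift` of `TorusAnalyticComposition`).

## References

* S. Armstrong, V. Vicol, Ann. PDE 11 (2025), arXiv:2305.05048, App. A Lemma 7.7, Cor. 7.8
  (arXiv §7.2 p. 72, (e.transport), (e.bear.salmon.1)–(e.bear.salmon.2), (e.vomit.1)–(e.vomit.2)).
  [`ArmstrongVicol2025`]
* T. Buckmaster, C. De Lellis, L. Székelyhidi Jr., V. Vicol, CPAM 72 (2019), App. B Prop. B.1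
  (the sup-norm transport estimate used for each `∂^l Y`). [`BuckmasterEtAl2018`]
-/

noncomputable section

open Set Function Finset MeasureTheory intervalIntegral
open scoped ContDiff

namespace Literature.Analysis.FunctionSpaces

namespace Torus

variable {d : Type*} [Fintype d] [DecidableEq d]

/-! ## §1 Spatial helpers over words -/

section Spatial

variable {F : Type*} [NormedAddCommGroup F] [NormedSpace ℝ F]

/-- For smooth `φ`, the outermost derivative may be moved innermost: `∂^{i :: l} φ = ∂^{l ++ [i]} φ`
(mixed partials commute). [folklore] -/
private theorem iterPartialDeriv_cons_eq_concat {φ : UnitAddTorus d → F} (hφ : IsSmooth φ) (i : d) :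
    ∀ l : List d, iterPartialDeriv (i :: l) φ = iterPartialDeriv (l ++ [i]) φ
  | [] => rfl
  | j :: l => by
    rw [List.cons_append, iterPartialDeriv_cons j (l ++ [i]), ← iterPartialDeriv_cons_eq_concat hφ i l,
      iterPartialDeriv_cons, iterPartialDeriv_cons, iterPartialDeriv_cons]
    funext x
    exact partialDeriv_comm (hφ.iterPartialDeriv l) i j x

omit [Fintype d] in
/-- `∂^l (−φ) = −∂^l φ`. [folklore] -/
private theorem iterPartialDeriv_neg (φ : UnitAddTorus d → F) :
    ∀ l : List d, iterPartialDeriv l (fun y => -φ y) = fun y => -iterPartialDeriv l φ y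
  | [] => rfl
  | i :: l => by
    rw [iterPartialDeriv_cons, iterPartialDeriv_neg φ l, iterPartialDeriv_cons]
    funext x
    exact partialDeriv_neg i _ x

omit [Fintype d] in
/-- `derivSup n (−φ) = derivSup n φ`. [cite: ArmstrongVicol2025, App. A (A.1)] -/
theorem derivSup_neg (n : ℕ) (φ : UnitAddTorus d → F) : derivSup n (fun y => -φ y) = derivSup n φ := by
  simp only [derivSup_def, iterPartialDeriv_neg, norm_neg]

omit [Fintype d] in
/-- `⟦−φ⟧_{n,R} = ⟦φ⟧_{n,R}`. [cite: ArmstrongVicol2025, App. A (A.1)] -/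
theorem dnorm_neg (n : ℕ) (R : ℝ) (φ : UnitAddTorus d → F) : dnorm n R (fun y => -φ y) = dnorm n R φ := by
  rw [dnorm_def, dnorm_def, derivSup_neg]

omit [Fintype d] in
/-- `derivSup n 0 = 0`. [cite: ArmstrongVicol2025, App. A (A.1)] -/
theorem derivSup_zero_fun (n : ℕ) : derivSup n (fun _ : UnitAddTorus d => (0 : F)) = 0 := by
  refine le_antisymm (derivSup_le le_rfl fun l _ y => ?_) (derivSup_nonneg _ _)
  by_cases hl : l = []
  · subst hl; simp
  · rw [iterPartialDeriv_const (0 : F) l hl]; simp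

/-- **Components are dominated by the vector** at the level of `derivSup`:
`derivSup n uᵢ ≤ derivSup n u`. [cite: ArmstrongVicol2025, App. A (A.1)] -/
theorem derivSup_apply_le (n : ℕ) {u : UnitAddTorus d → EuclideanSpace ℝ d} (hu : IsSmooth u) (i : d) :
    derivSup n (fun y => u y i) ≤ derivSup n u := by
  refine derivSup_le (derivSup_nonneg _ _) fun l hl y => ?_
  rw [iterPartialDeriv_apply_coord hu i l]
  have h1 : ‖iterPartialDeriv l u y i‖ ≤ ‖iterPartialDeriv l u y‖ := by
    simpa using PiLp.norm_apply_le (iterPartialDeriv l u y) i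
  exact h1.trans (hl ▸ norm_iterPartialDeriv_le_derivSup hu l y)

/-- `derivSup k f ≤ C k! Rᵏ/(k+1)²` from `⟦f⟧_{k,R} ≤ C`. [cite: ArmstrongVicol2025, App. A (A.1)] -/
theorem derivSup_le_of_dnorm_le {k : ℕ} {R C : ℝ} {f : UnitAddTorus d → F} (hf : IsSmooth f) (hR : 0 < R)
    (h : dnorm k R f ≤ C) : derivSup k f ≤ C * ((Nat.factorial k : ℝ) * R ^ k) / ((k : ℝ) + 1) ^ 2 := by
  have hC : 0 ≤ C := (dnorm_nonneg k hR.le f).trans h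
  exact derivSup_le (by positivity) fun l hl y => norm_iterPartialDeriv_le_of_dnorm_le hf hR h hl y

/-- **Commutator Leibniz bound.** For smooth real `a`, `ψ` and a word `l` of length `n`,
`‖∂^l(a ψ)(y) − a(y) ∂^l ψ(y)‖ ≤ Σ_{k<n} C(n,k+1) · derivSup (k+1) a · derivSup (n−1−k) ψ`
(the binomial Leibniz expansion with the term in which no derivative falls on `a` removed;
induction on `n` as for `norm_iterPartialDeriv_mul_le_sum`, Pascal's rule).
[cite: ArmstrongVicol2025, App. A Lemma 7.7 (proof, (e.transport.aa))] -/
theorem norm_iterPartialDeriv_mul_sub_mul_le_sum :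
    ∀ (n : ℕ) {a ψ : UnitAddTorus d → ℝ}, IsSmooth a → IsSmooth ψ → ∀ l : List d, l.length = n →
      ∀ y, ‖iterPartialDeriv l (fun y => a y * ψ y) y - a y * iterPartialDeriv l ψ y‖ ≤
        ∑ k ∈ Finset.range n, (n.choose (k + 1) : ℝ) * (derivSup (k + 1) a * derivSup (n - 1 - k) ψ) := by
  intro n
  induction n with
  | zero =>
    intro a ψ _ _ l hl y
    have hl0 : l = [] := List.eq_nil_of_length_eq_zero hl
    subst hl0
    simp
  | succ n ih =>
    intro a ψ ha hψ l hl y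
    obtain ⟨l', i, rfl, hlen'⟩ := List.exists_eq_concat_of_length_eq_succ hl
    have h1a : IsContDiff 1 a := ha.isContDiff (by simp)
    have h1ψ : IsContDiff 1 ψ := hψ.isContDiff (by simp)
    have hprod : Torus.partialDeriv i (fun y => a y * ψ y) =
        fun y => a y * Torus.partialDeriv i ψ y + Torus.partialDeriv i a y * ψ y :=
      funext fun y => partialDeriv_mul h1a h1ψ i y
    have hA : IsSmooth fun y => a y * Torus.partialDeriv i ψ y :=
      (ContDiff.mul ha (hψ.partialDeriv i) : IsSmooth fun y => a y * Torus.partialDeriv i ψ y)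
    have hB : IsSmooth fun y => Torus.partialDeriv i a y * ψ y :=
      (ContDiff.mul (ha.partialDeriv i) hψ : IsSmooth fun y => Torus.partialDeriv i a y * ψ y)
    rw [iterPartialDeriv_concat, iterPartialDeriv_concat, hprod, iterPartialDeriv_add hA hB l']
    -- the two pieces
    have e1 := ih ha (hψ.partialDeriv i) l' hlen' y
    have e2 := norm_iterPartialDeriv_mul_le_sum n (ha.partialDeriv i) hψ l' hlen' y
    have s1 : ∑ k ∈ Finset.range n, (n.choose (k + 1) : ℝ) *
          (derivSup (k + 1) a * derivSup (n - 1 - k) (Torus.partialDeriv i ψ)) ≤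
        ∑ k ∈ Finset.range n, (n.choose (k + 1) : ℝ) * (derivSup (k + 1) a * derivSup (n - k) ψ) := by
      refine Finset.sum_le_sum fun k hk => mul_le_mul_of_nonneg_left
        (mul_le_mul_of_nonneg_left ?_ (derivSup_nonneg _ _)) (Nat.cast_nonneg _)
      have hk' : k < n := Finset.mem_range.1 hk
      have e : n - k = (n - 1 - k) + 1 := by omega
      rw [e]
      exact derivSup_partialDeriv_le hψ i (n - 1 - k)
    have s2 : ∑ k ∈ Finset.range (n + 1), (n.choose k : ℝ) *
          (derivSup k (Torus.partialDeriv i a) * derivSup (n - k) ψ) ≤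
        ∑ k ∈ Finset.range (n + 1), (n.choose k : ℝ) * (derivSup (k + 1) a * derivSup (n - k) ψ) :=
      Finset.sum_le_sum fun k _ => mul_le_mul_of_nonneg_left
        (mul_le_mul_of_nonneg_right (derivSup_partialDeriv_le ha i k) (derivSup_nonneg _ _)) (Nat.cast_nonneg _)
    -- Pascal: `C(n+1,k+1) = C(n,k) + C(n,k+1)`, and `C(n,n+1) = 0`
    have hsplit : ∑ k ∈ Finset.range (n + 1), ((n + 1).choose (k + 1) : ℝ) *
          (derivSup (k + 1) a * derivSup (n + 1 - 1 - k) ψ) =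
        ∑ k ∈ Finset.range (n + 1), (n.choose k : ℝ) * (derivSup (k + 1) a * derivSup (n - k) ψ) +
          ∑ k ∈ Finset.range n, (n.choose (k + 1) : ℝ) * (derivSup (k + 1) a * derivSup (n - k) ψ) := by
      have e3 : ∀ k ∈ Finset.range (n + 1), ((n + 1).choose (k + 1) : ℝ) *
            (derivSup (k + 1) a * derivSup (n + 1 - 1 - k) ψ) =
          (n.choose k : ℝ) * (derivSup (k + 1) a * derivSup (n - k) ψ) +
            (n.choose (k + 1) : ℝ) * (derivSup (k + 1) a * derivSup (n - k) ψ) := by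
        intro k _
        rw [Nat.choose_succ_succ, Nat.cast_add, show n + 1 - 1 - k = n - k by omega]
        ring
      rw [Finset.sum_congr rfl e3, Finset.sum_add_distrib, Finset.sum_range_succ (fun k =>
        (n.choose (k + 1) : ℝ) * (derivSup (k + 1) a * derivSup (n - k) ψ)) n, Nat.choose_succ_self]
      simp
    rw [hsplit]
    have ecomb : iterPartialDeriv l' (fun y => a y * Torus.partialDeriv i ψ y) y +
          iterPartialDeriv l' (fun y => Torus.partialDeriv i a y * ψ y) y -
          a y * iterPartialDeriv l' (Torus.partialDeriv i ψ) y =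
        (iterPartialDeriv l' (fun y => a y * Torus.partialDeriv i ψ y) y -
            a y * iterPartialDeriv l' (Torus.partialDeriv i ψ) y) +
          iterPartialDeriv l' (fun y => Torus.partialDeriv i a y * ψ y) y := by ring
    rw [ecomb]
    refine (norm_add_le _ _).trans ?_
    rw [add_comm]
    exact add_le_add (e2.trans s2) (e1.trans s1)

end Spatial

/-! ## §2 Elementary weight sums -/

section Weights

/-- `Σ_{k<K} 1/(k+2)² ≤ 1 − 1/(K+1)` (telescoping `1/(k+2)² ≤ 1/(k+1) − 1/(k+2)`). [folklore] -/
private theorem sum_inv_sq_add_two_le (K : ℕ) :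
    ∑ k ∈ Finset.range K, 1 / ((k : ℝ) + 2) ^ 2 ≤ 1 - 1 / ((K : ℝ) + 1) := by
  induction K with
  | zero => norm_num
  | succ K ih =>
    rw [Finset.sum_range_succ]
    push_cast
    have hk1 : (0 : ℝ) < (K : ℝ) + 1 := by positivity
    have hk2 : (0 : ℝ) < (K : ℝ) + 2 := by positivity
    have hstep : 1 / ((K : ℝ) + 2) ^ 2 ≤ 1 / ((K : ℝ) + 1) - 1 / ((K : ℝ) + 1 + 1) := by
      rw [show (K : ℝ) + 1 + 1 = (K : ℝ) + 2 by ring, div_sub_div _ _ hk1.ne' hk2.ne',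
        div_le_div_iff₀ (by positivity) (by positivity)]
      nlinarith
    linarith

/-- `Σ_{k<K} 1/(k+3)² ≤ 1/2 − 1/(K+2)`. [folklore] -/
private theorem sum_inv_sq_add_three_le (K : ℕ) :
    ∑ k ∈ Finset.range K, 1 / ((k : ℝ) + 3) ^ 2 ≤ 1 / 2 - 1 / ((K : ℝ) + 2) := by
  induction K with
  | zero => norm_num
  | succ K ih =>
    rw [Finset.sum_range_succ]
    push_cast
    have hk2 : (0 : ℝ) < (K : ℝ) + 2 := by positivity
    have hk3 : (0 : ℝ) < (K : ℝ) + 3 := by positivity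
    have hstep : 1 / ((K : ℝ) + 3) ^ 2 ≤ 1 / ((K : ℝ) + 2) - 1 / ((K : ℝ) + 1 + 2) := by
      rw [show (K : ℝ) + 1 + 2 = (K : ℝ) + 3 by ring, div_sub_div _ _ hk2.ne' hk3.ne',
        div_le_div_iff₀ (by positivity) (by positivity)]
      nlinarith
    linarith

/-- **The lower-order weight sum of the inductive step**: for `n ≥ 1`,
`Σ_{k<n−1} (n+1)²/((k+3)² (n−k)²) ≤ 3` (partial fractions `1/((k+3)(n−k)) = (1/(n+3))(1/(k+3) + 1/(n−k))`,
`(x+y)² ≤ 2x² + 2y²`, and the two telescoping sums). This is the sum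
`Σ_{k=0}^{n-2} (n+1)²/((n-k+1)²(k+2)²)` of Armstrong–Vicol's display (p. 72), re-indexed.
[cite: ArmstrongVicol2025, App. A Lemma 7.7 (proof, "∑ (n+1)²(k+1)⁻²(n−k+1)⁻² ≤ 3/2")] -/
theorem sum_weight_lowerOrder_le_three (n : ℕ) :
    ∑ k ∈ Finset.range (n - 1), ((n : ℝ) + 1) ^ 2 / (((k : ℝ) + 3) ^ 2 * ((n : ℝ) - k) ^ 2) ≤ 3 := by
  have hterm : ∀ k ∈ Finset.range (n - 1),
      ((n : ℝ) + 1) ^ 2 / (((k : ℝ) + 3) ^ 2 * ((n : ℝ) - k) ^ 2) ≤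
        2 * (1 / ((k : ℝ) + 3) ^ 2) + 2 * (1 / (((n - 2 - k : ℕ) : ℝ) + 2) ^ 2) := by
    intro k hk
    have hk' : k < n - 1 := Finset.mem_range.1 hk
    have hcast : (((n - 2 - k : ℕ) : ℝ) + 2) = (n : ℝ) - k := by
      have : k + 2 ≤ n := by omega
      rw [Nat.cast_sub (by omega), Nat.cast_sub (by omega)]
      push_cast
      ring
    rw [hcast]
    have ha : (0 : ℝ) < (k : ℝ) + 3 := by positivity
    have hb : (0 : ℝ) < (n : ℝ) - k := by
      have : (k : ℝ) + 1 < n := by exact_mod_cast (show k + 1 < n by omega)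
      linarith
    -- with `x = 1/(k+3)`, `y = 1/(n-k)`: `(n+1)²/((k+3)²(n-k)²) ≤ (n+3)² x² y² = (x+y)² ≤ 2x²+2y²`
    have hxy : 1 / ((k : ℝ) + 3) + 1 / ((n : ℝ) - k) = ((n : ℝ) + 3) / (((k : ℝ) + 3) * ((n : ℝ) - k)) := by
      field_simp
      ring
    have h1 : ((n : ℝ) + 1) ^ 2 / (((k : ℝ) + 3) ^ 2 * ((n : ℝ) - k) ^ 2) ≤
        (1 / ((k : ℝ) + 3) + 1 / ((n : ℝ) - k)) ^ 2 := by
      rw [hxy, div_pow, mul_pow]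
      exact div_le_div_of_nonneg_right (by nlinarith) (by positivity)
    have h2 : (1 / ((k : ℝ) + 3) + 1 / ((n : ℝ) - k)) ^ 2 ≤
        2 * (1 / ((k : ℝ) + 3) ^ 2) + 2 * (1 / ((n : ℝ) - k) ^ 2) := by
      have e1 : (1 : ℝ) / ((k : ℝ) + 3) ^ 2 = (1 / ((k : ℝ) + 3)) ^ 2 := by rw [one_div_pow]
      have e2 : (1 : ℝ) / ((n : ℝ) - k) ^ 2 = (1 / ((n : ℝ) - k)) ^ 2 := by rw [one_div_pow]
      rw [e1, e2]
      nlinarith [sq_nonneg (1 / ((k : ℝ) + 3) - 1 / ((n : ℝ) - k))]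
    exact h1.trans h2
  refine (Finset.sum_le_sum hterm).trans ?_
  rw [Finset.sum_add_distrib, ← Finset.mul_sum, ← Finset.mul_sum]
  have hA := sum_inv_sq_add_three_le (n - 1)
  have hB : ∑ k ∈ Finset.range (n - 1), 1 / (((n - 2 - k : ℕ) : ℝ) + 2) ^ 2 ≤ 1 - 1 / (((n - 1 : ℕ) : ℝ) + 1) := by
    have href := Finset.sum_range_reflect (fun k : ℕ => 1 / ((k : ℝ) + 2) ^ 2) (n - 1)
    have e : ∀ k ∈ Finset.range (n - 1), 1 / (((n - 2 - k : ℕ) : ℝ) + 2) ^ 2 =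
        1 / (((n - 1 - 1 - k : ℕ) : ℝ) + 2) ^ 2 := by
      intro k _
      rw [show n - 1 - 1 - k = n - 2 - k by omega]
    rw [Finset.sum_congr rfl e, href]
    exact sum_inv_sq_add_two_le (n - 1)
  have hpos1 : 0 ≤ 1 / (((n - 1 : ℕ) : ℝ) + 2) := by positivity
  have hpos2 : 0 ≤ 1 / (((n - 1 : ℕ) : ℝ) + 1) := by positivity
  linarith

end Weights

/-! ## §3 Slab calculus: the transported derivatives -/

section Slab

variable {F : Type*} [NormedAddCommGroup F] [NormedSpace ℝ F]

/-- **`∂ₜ` commutes with `∂^l` within `[a,b]`** for jointly smooth fields (iterate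
`timeDerivWithin_partialDeriv_comm`). [folklore] -/
private theorem timeDerivWithin_iterPartialDeriv_comm {a b : ℝ} (hab : a < b) {u : ℝ → UnitAddTorus d → F}
    (hu : IsSmoothSpaceTimeOn (Icc a b) u) {t : ℝ} (ht : t ∈ Icc a b) :
    ∀ (l : List d) (x : UnitAddTorus d),
      timeDerivWithin (Icc a b) (fun s => iterPartialDeriv l (u s)) t x =
        iterPartialDeriv l (timeDerivWithin (Icc a b) u t) x
  | [], _ => rfl
  | i :: l, x => by
    have hS : UniqueDiffOn ℝ (Icc a b) := uniqueDiffOn_Icc hab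
    have hU : IsSmoothSpaceTimeOn (Icc a b) (fun s => iterPartialDeriv l (u s)) := hu.iterPartialDeriv hS l
    have h1 := timeDerivWithin_partialDeriv_comm hab hU ht i x
    simp only [iterPartialDeriv_cons]
    rw [h1]
    have h2 : timeDerivWithin (Icc a b) (fun s => iterPartialDeriv l (u s)) t =
        iterPartialDeriv l (timeDerivWithin (Icc a b) u t) :=
      funext fun y => timeDerivWithin_iterPartialDeriv_comm hab hu ht l y
    rw [h2]

omit [DecidableEq d] in
/-- On a smaller time set of unique differentiability the one-sided time derivative of a jointly
smooth field is unchanged. [folklore] -/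
private theorem timeDerivWithin_eq_of_subset' {S S' : Set ℝ} {w : ℝ → UnitAddTorus d → F}
    (h : IsSmoothSpaceTimeOn S w) (hS' : S' ⊆ S) (hU : UniqueDiffOn ℝ S') {t : ℝ} (ht : t ∈ S')
    (x : UnitAddTorus d) : timeDerivWithin S' w t x = timeDerivWithin S w t x :=
  ((h.hasDerivWithinAt_slice (hS' ht) x).mono hS').derivWithin (hU t ht)

omit [Fintype d] [DecidableEq d] in
/-- A pointwise `HasDerivAt` form of an evolution equation gives the within-slab form. [folklore] -/
private theorem timeDerivWithin_eq_of_hasDerivAt {a b : ℝ} (hab : a < b) {w : ℝ → UnitAddTorus d → F}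
    {w' : ℝ → UnitAddTorus d → F} (h : ∀ t x, HasDerivAt (fun s => w s x) (w' t x) t) {t : ℝ}
    (ht : t ∈ Icc a b) (x : UnitAddTorus d) : timeDerivWithin (Icc a b) w t x = w' t x :=
  (h t x).hasDerivWithinAt.derivWithin (uniqueDiffOn_Icc hab t ht)

/-- **The convective commutator bound**: for a smooth velocity slice `u` and a smooth scalar `φ`,
`|∂^l((u·∇)φ)(x) − (u·∇)(∂^l φ)(x)| ≤ d Σ_{k<n} C(n,k+1) derivSup (k+1) u · derivSup (n−k) φ`
(`|l| = n`; the Leibniz terms in which at least one derivative falls on `u`).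
[cite: ArmstrongVicol2025, App. A Lemma 7.7 (proof, (e.transport.aa))] -/
theorem abs_iterPartialDeriv_convect_sub_le {u : UnitAddTorus d → EuclideanSpace ℝ d} (hu : IsSmooth u)
    {φ : UnitAddTorus d → ℝ} (hφ : IsSmooth φ) {n : ℕ} {l : List d} (hl : l.length = n)
    (x : UnitAddTorus d) :
    |iterPartialDeriv l (convect u φ) x - convect u (iterPartialDeriv l φ) x| ≤
      (Fintype.card d : ℝ) * ∑ k ∈ Finset.range n,
        (n.choose (k + 1) : ℝ) * (derivSup (k + 1) u * derivSup (n - k) φ) := by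
  have h1φ : IsContDiff 1 φ := hφ.isContDiff (by simp)
  have h1lφ : IsContDiff 1 (iterPartialDeriv l φ) := (hφ.iterPartialDeriv l).isContDiff (by simp)
  have hconv : convect u φ = fun y => ∑ j, u y j * Torus.partialDeriv j φ y := by
    funext y
    rw [convect_eq_sum_smul_partialDeriv h1φ]
    rfl
  have hterm : ∀ j, IsSmooth (fun y => u y j * Torus.partialDeriv j φ y) := fun j =>
    (ContDiff.mul (hu.apply j) (hφ.partialDeriv j) : IsSmooth fun y => u y j * Torus.partialDeriv j φ y)
  have e1 : iterPartialDeriv l (convect u φ) x = ∑ j, iterPartialDeriv l (fun y => u y j * Torus.partialDeriv j φ y) x := by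
    rw [hconv, iterPartialDeriv_finset_sum _ (fun j _ => hterm j) l]
  have e2 : convect u (iterPartialDeriv l φ) x = ∑ j, u x j * iterPartialDeriv l (Torus.partialDeriv j φ) x := by
    rw [convect_eq_sum_smul_partialDeriv h1lφ]
    refine Finset.sum_congr rfl fun j _ => ?_
    rw [smul_eq_mul, ← iterPartialDeriv_concat, ← iterPartialDeriv_cons_eq_concat hφ j l, iterPartialDeriv_cons]
  rw [e1, e2, ← Finset.sum_sub_distrib]
  refine (Finset.abs_sum_le_sum_abs _ _).trans ?_
  have hcard : (Fintype.card d : ℝ) * ∑ k ∈ Finset.range n,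
      (n.choose (k + 1) : ℝ) * (derivSup (k + 1) u * derivSup (n - k) φ) =
      ∑ _j : d, ∑ k ∈ Finset.range n, (n.choose (k + 1) : ℝ) * (derivSup (k + 1) u * derivSup (n - k) φ) := by
    rw [Finset.sum_const, Finset.card_univ, nsmul_eq_mul]
  rw [hcard]
  refine Finset.sum_le_sum fun j _ => ?_
  have h := norm_iterPartialDeriv_mul_sub_mul_le_sum n (hu.apply j) (hφ.partialDeriv j) l hl x
  rw [Real.norm_eq_abs] at h
  refine h.trans (Finset.sum_le_sum fun k hk => ?_)
  have hk' : k < n := Finset.mem_range.1 hk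
  refine mul_le_mul_of_nonneg_left ?_ (Nat.cast_nonneg _)
  refine mul_le_mul (derivSup_apply_le (k + 1) hu j) ?_ (derivSup_nonneg _ _) (derivSup_nonneg _ _)
  have e : n - k = (n - 1 - k) + 1 := by omega
  rw [e]
  exact derivSup_partialDeriv_le hφ j (n - 1 - k)

/-- **The transported equation for `∂^l Y`.** If `∂ₜY + (f·∇)Y = g` on `[a,b] × T^d` (scalar `Y`,
all fields jointly smooth), then `Z = ∂^l Y` solves `∂ₜZ + (f·∇)Z = ∂^l g − ([∂^l, f·∇] Y)`.
[cite: ArmstrongVicol2025, App. A Lemma 7.7 (proof, (e.transport.aa))] -/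
theorem transport_iterPartialDeriv {a b : ℝ} (hab : a < b) {f : ℝ → UnitAddTorus d → EuclideanSpace ℝ d}
    {Y g : ℝ → UnitAddTorus d → ℝ} (hf : IsSmoothSpaceTimeOn (Icc a b) f)
    (hY : IsSmoothSpaceTimeOn (Icc a b) Y) (hg : IsSmoothSpaceTimeOn (Icc a b) g)
    (heq : ∀ t ∈ Icc a b, ∀ x, timeDerivWithin (Icc a b) Y t x + convect (f t) (Y t) x = g t x)
    (l : List d) {t : ℝ} (ht : t ∈ Icc a b) (x : UnitAddTorus d) :
    timeDerivWithin (Icc a b) (fun s => iterPartialDeriv l (Y s)) t x + convect (f t) (iterPartialDeriv l (Y t)) x =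
      iterPartialDeriv l (g t) x -
        (iterPartialDeriv l (convect (f t) (Y t)) x - convect (f t) (iterPartialDeriv l (Y t)) x) := by
  have hS : UniqueDiffOn ℝ (Icc a b) := uniqueDiffOn_Icc hab
  have hgt : IsSmooth (g t) := hg.isSmooth_slice ht
  have hct : IsSmooth (convect (f t) (Y t)) := (hf.convect hY hS).isSmooth_slice ht
  have hneg : IsSmooth (fun y => -convect (f t) (Y t) y) := hct.neg
  have hfun : timeDerivWithin (Icc a b) Y t = fun y => g t y + (fun z => -convect (f t) (Y t) z) y := by
    funext y
    have h := heq t ht y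
    simp only
    linarith
  rw [timeDerivWithin_iterPartialDeriv_comm hab hY ht l x, hfun,
    iterPartialDeriv_add hgt hneg l, iterPartialDeriv_neg]
  ring

omit [DecidableEq d] in
/-- **A priori time-Lipschitz bound on a compact slab**: a jointly smooth field on `[0,T] × T^d`
satisfies `‖U s' x − U s x‖ ≤ L |s' − s|` with one constant `L` (its time derivative is bounded on
the compact slab; mean value inequality). [folklore] -/
private theorem exists_lipschitz_time {T : ℝ} (hT : 0 < T) {U : ℝ → UnitAddTorus d → F}
    (hU : IsSmoothSpaceTimeOn (Icc 0 T) U) :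
    ∃ L : ℝ, 0 ≤ L ∧ ∀ s ∈ Icc 0 T, ∀ s' ∈ Icc 0 T, ∀ x, ‖U s' x - U s x‖ ≤ L * |s' - s| := by
  have hS : UniqueDiffOn ℝ (Icc 0 T) := uniqueDiffOn_Icc hT
  obtain ⟨C, hC⟩ := (hU.timeDerivWithin hS).exists_norm_le_of_isCompact isCompact_Icc subset_rfl
  refine ⟨max C 0, le_max_right _ _, fun s hs s' hs' x => ?_⟩
  have h := (convex_Icc 0 T).norm_image_sub_le_of_norm_hasDerivWithin_le
    (f := fun τ => U τ x) (f' := fun τ => timeDerivWithin (Icc 0 T) U τ x) (C := max C 0)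
    (fun τ hτ => hU.hasDerivWithinAt_slice hτ x) (fun τ hτ => (hC τ hτ x).trans (le_max_left C 0)) hs hs'
  rwa [Real.norm_eq_abs] at h

/-- **Uniform time-Lipschitz bound for all spatial derivatives of order `n`** on the compact slab,
and its consequence for `derivSup`: `derivSup n (Y s') ≤ derivSup n (Y s) + L |s' − s|`. [folklore] -/
private theorem exists_derivSup_sub_le {T : ℝ} (hT : 0 < T) {Y : ℝ → UnitAddTorus d → F}
    (hY : IsSmoothSpaceTimeOn (Icc 0 T) Y) (n : ℕ) :
    ∃ L : ℝ, 0 ≤ L ∧ ∀ s ∈ Icc 0 T, ∀ s' ∈ Icc 0 T, derivSup n (Y s') ≤ derivSup n (Y s) + L * |s' - s| := by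
  have hS : UniqueDiffOn ℝ (Icc 0 T) := uniqueDiffOn_Icc hT
  have hv : ∀ v : List.Vector d n, ∃ L : ℝ, 0 ≤ L ∧ ∀ s ∈ Icc 0 T, ∀ s' ∈ Icc 0 T, ∀ x,
      ‖iterPartialDeriv v.toList (Y s') x - iterPartialDeriv v.toList (Y s) x‖ ≤ L * |s' - s| := fun v =>
    exists_lipschitz_time hT (hY.iterPartialDeriv hS v.toList)
  choose L hL0 hL using hv
  refine ⟨∑ v, L v, Finset.sum_nonneg fun v _ => hL0 v, fun s hs s' hs' => ?_⟩
  have hsum : ∀ v, L v ≤ ∑ v, L v := fun v => Finset.single_le_sum (fun v _ => hL0 v) (Finset.mem_univ v)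
  refine derivSup_le (add_nonneg (derivSup_nonneg _ _)
    (mul_nonneg (Finset.sum_nonneg fun v _ => hL0 v) (abs_nonneg _))) fun l hl y => ?_
  have h1 := hL ⟨l, hl⟩ s hs s' hs' y
  have h2 : ‖iterPartialDeriv l (Y s) y‖ ≤ derivSup n (Y s) := hl ▸ norm_iterPartialDeriv_le_derivSup (hY.isSmooth_slice hs) l y
  calc ‖iterPartialDeriv l (Y s') y‖
      ≤ ‖iterPartialDeriv l (Y s) y‖ + ‖iterPartialDeriv l (Y s') y - iterPartialDeriv l (Y s) y‖ :=
        norm_le_insert' _ _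
    _ ≤ derivSup n (Y s) + (∑ v, L v) * |s' - s| :=
        add_le_add h2 (h1.trans (mul_le_mul_of_nonneg_right (hsum ⟨l, hl⟩) (abs_nonneg _)))

end Slab

/-! ## §4 The inductive step: budget algebra, one bootstrap pass, continuation in time -/

section Budget

/-- `d/ds (R_g + r s)^{j+1}/((j+1) r) = (R_g + r s)^j` (`r ≠ 0`). [folklore] -/
private theorem hasDerivAt_radius_pow (Rg r : ℝ) (hr : r ≠ 0) (j : ℕ) (s : ℝ) :
    HasDerivAt (fun s => (Rg + r * s) ^ (j + 1) / (((j : ℝ) + 1) * r)) ((Rg + r * s) ^ j) s := by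
  have h1 : HasDerivAt (fun s => Rg + r * s) r s := by
    simpa using ((hasDerivAt_id s).const_mul r).const_add Rg
  have h2 : HasDerivAt (fun s => (Rg + r * s) ^ (j + 1) / (((j : ℝ) + 1) * r))
      ((((j + 1 : ℕ) : ℝ) * (Rg + r * s) ^ (j + 1 - 1) * r) / (((j : ℝ) + 1) * r)) s :=
    ((hasDerivAt_pow (j + 1) (Rg + r * s)).comp s h1).div_const _
  have hj : ((j : ℝ) + 1) ≠ 0 := by positivity
  have e : (((j + 1 : ℕ) : ℝ) * (Rg + r * s) ^ (j + 1 - 1) * r) / (((j : ℝ) + 1) * r) = (Rg + r * s) ^ j := by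
    rw [Nat.add_sub_cancel]
    push_cast
    field_simp
  rw [e] at h2
  exact h2

/-- `C(n,k+1) (k+1)! (j+1)! = n! (j+1)` when `k + 1 + j = n`. [folklore] -/
private theorem cast_choose_mul_factorial_mul_factorial_succ {n k j : ℕ} (h : k + 1 + j = n) :
    (n.choose (k + 1) : ℝ) * ((Nat.factorial (k + 1) : ℕ) : ℝ) * ((Nat.factorial (j + 1) : ℕ) : ℝ) =
      (Nat.factorial n : ℝ) * ((j : ℝ) + 1) := by
  have h1 : n.choose (k + 1) * Nat.factorial (k + 1) * Nat.factorial j = Nat.factorial n := by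
    have := Nat.choose_mul_factorial_mul_factorial (show k + 1 ≤ n by omega)
    rwa [show n - (k + 1) = j by omega] at this
  have h1' : (n.choose (k + 1) : ℝ) * ((Nat.factorial (k + 1) : ℕ) : ℝ) * ((Nat.factorial j : ℕ) : ℝ) =
      (Nat.factorial n : ℝ) := by exact_mod_cast h1
  rw [Nat.factorial_succ j]
  push_cast
  calc (n.choose (k + 1) : ℝ) * ((Nat.factorial (k + 1) : ℕ) : ℝ) * (((j : ℝ) + 1) * (Nat.factorial j : ℝ))
      = ((n.choose (k + 1) : ℝ) * ((Nat.factorial (k + 1) : ℕ) : ℝ) * (Nat.factorial j : ℝ)) * ((j : ℝ) + 1) := by ring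
    _ = (Nat.factorial n : ℝ) * ((j : ℝ) + 1) := by rw [h1']

/-- **The `k`-th source term of the bootstrap majorant, integrated and reduced**: with
`r = 4 D C_f R_f R_g`, `k + 1 + j = n`,
`D · C(n,k+1) · (C_f (k+1)! R_f^{k+1}/(k+2)²) · (M(t+ε)) · ((j+1)!/(j+2)²) · (R^{j+2} − R_g^{j+2})/((j+2) r)
  ≤ M (t+ε) n! (j+1) R_f^k R^{j+2}/(4 R_g (k+2)² (j+2)³)`.
[cite: ArmstrongVicol2025, App. A Lemma 7.7 (proof, (e.vomit.2))] -/
theorem bootstrap_term_le {n k j : ℕ} (h : k + 1 + j = n) {D Cf Rf Rg R M t ε : ℝ} (hD : 0 < D)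
    (hCf : 0 < Cf) (hRf : 0 < Rf) (hRg : 0 < Rg) (hM : 0 ≤ M) (htε : 0 ≤ t + ε) :
    D * ((n.choose (k + 1) : ℝ) * (Cf * (((Nat.factorial (k + 1) : ℕ) : ℝ) * Rf ^ (k + 1)) /
        ((((k + 1 : ℕ) : ℝ)) + 1) ^ 2) * (M * (t + ε)) *
        ((((Nat.factorial (j + 1) : ℕ) : ℝ)) / ((((j + 1 : ℕ) : ℝ)) + 1) ^ 2) *
        ((R ^ (j + 2) - Rg ^ (j + 2)) / (((((j + 1 : ℕ) : ℝ)) + 1) * (4 * D * Cf * Rf * Rg)))) ≤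
      M * (t + ε) * (Nat.factorial n : ℝ) * ((j : ℝ) + 1) * Rf ^ k * R ^ (j + 2) /
        (4 * Rg * ((k : ℝ) + 2) ^ 2 * ((j : ℝ) + 2) ^ 3) := by
  have hid := cast_choose_mul_factorial_mul_factorial_succ h
  push_cast at hid ⊢
  have hk2 : (0 : ℝ) < (k : ℝ) + 1 + 1 := by positivity
  have hj2 : (0 : ℝ) < (j : ℝ) + 1 + 1 := by positivity
  -- drop the `R_g^{j+2}` term
  have hdrop : (R ^ (j + 2) - Rg ^ (j + 2)) / (((j : ℝ) + 1 + 1) * (4 * D * Cf * Rf * Rg)) ≤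
      R ^ (j + 2) / (((j : ℝ) + 1 + 1) * (4 * D * Cf * Rf * Rg)) :=
    div_le_div_of_nonneg_right (sub_le_self _ (pow_nonneg hRg.le _)) (by positivity)
  have hpre : 0 ≤ D * ((n.choose (k + 1) : ℝ) * (Cf * ((Nat.factorial (k + 1) : ℝ) * Rf ^ (k + 1)) /
      ((k : ℝ) + 1 + 1) ^ 2) * (M * (t + ε)) * ((Nat.factorial (j + 1) : ℝ) / ((j : ℝ) + 1 + 1) ^ 2)) := by
    positivity
  calc D * ((n.choose (k + 1) : ℝ) * (Cf * ((Nat.factorial (k + 1) : ℝ) * Rf ^ (k + 1)) / ((k : ℝ) + 1 + 1) ^ 2) *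
          (M * (t + ε)) * ((Nat.factorial (j + 1) : ℝ) / ((j : ℝ) + 1 + 1) ^ 2) *
          ((R ^ (j + 2) - Rg ^ (j + 2)) / (((j : ℝ) + 1 + 1) * (4 * D * Cf * Rf * Rg))))
      = (D * ((n.choose (k + 1) : ℝ) * (Cf * ((Nat.factorial (k + 1) : ℝ) * Rf ^ (k + 1)) / ((k : ℝ) + 1 + 1) ^ 2) *
          (M * (t + ε)) * ((Nat.factorial (j + 1) : ℝ) / ((j : ℝ) + 1 + 1) ^ 2))) *
          ((R ^ (j + 2) - Rg ^ (j + 2)) / (((j : ℝ) + 1 + 1) * (4 * D * Cf * Rf * Rg))) := by ring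
    _ ≤ (D * ((n.choose (k + 1) : ℝ) * (Cf * ((Nat.factorial (k + 1) : ℝ) * Rf ^ (k + 1)) / ((k : ℝ) + 1 + 1) ^ 2) *
          (M * (t + ε)) * ((Nat.factorial (j + 1) : ℝ) / ((j : ℝ) + 1 + 1) ^ 2))) *
          (R ^ (j + 2) / (((j : ℝ) + 1 + 1) * (4 * D * Cf * Rf * Rg))) :=
        mul_le_mul_of_nonneg_left hdrop hpre
    _ = M * (t + ε) * ((n.choose (k + 1) : ℝ) * (Nat.factorial (k + 1) : ℝ) * (Nat.factorial (j + 1) : ℝ)) *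
          Rf ^ k * R ^ (j + 2) / (4 * Rg * ((k : ℝ) + 2) ^ 2 * ((j : ℝ) + 2) ^ 3) := by
        rw [pow_succ]
        field_simp
        ring
    _ = M * (t + ε) * (Nat.factorial n : ℝ) * ((j : ℝ) + 1) * Rf ^ k * R ^ (j + 2) /
          (4 * Rg * ((k : ℝ) + 2) ^ 2 * ((j : ℝ) + 2) ^ 3) := by
        rw [hid]
        ring

/-- **The budget of one bootstrap pass** (Armstrong–Vicol's display on p. 72 with the corrected
self-interaction coefficient): with `R = R_g(1 + 4 t D C_f R_f) ≤ 2R_g`, `M = 8 D C_g`, the integrated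
majorant is at most `(1 − 1/(8(n+1))) · M (t+ε) n! Rⁿ/(n+1)²`: the `g`-term contributes `≤ 1/8`, the
order-`n` self-interaction `≤ n/(8(n+1))`, the lower orders `≤ (1/4)·3`.
[cite: ArmstrongVicol2025, App. A Lemma 7.7 (proof, p. 72)] -/
theorem bootstrap_budget_le {n : ℕ} (hn : 1 ≤ n) {D Cf Rf Cg Rg t ε R r M : ℝ} (hD1 : 1 ≤ D)
    (hCf : 0 < Cf) (hRf : 0 < Rf) (hCg : 0 < Cg) (hRg : 0 < Rg) (hRfg : Rf ≤ Rg) (ht : 0 ≤ t)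
    (htT : t * (4 * D * Cf * Rf) ≤ 1) (hε : 0 < ε) (hR : R = Rg * (1 + 4 * t * D * Cf * Rf))
    (hr : r = 4 * D * Cf * Rf * Rg) (hM : M = 8 * D * Cg) :
    Cg * ((Nat.factorial n : ℝ) * Rg ^ n) / ((n : ℝ) + 1) ^ 2 * t +
      D * ∑ k ∈ Finset.range n, (n.choose (k + 1) : ℝ) *
        (Cf * (((Nat.factorial (k + 1) : ℕ) : ℝ) * Rf ^ (k + 1)) / ((((k + 1 : ℕ) : ℝ)) + 1) ^ 2) * (M * (t + ε)) *
        ((((Nat.factorial (n - k) : ℕ) : ℝ)) / ((((n - k : ℕ) : ℝ)) + 1) ^ 2) *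
        ((R ^ (n - k + 1) - Rg ^ (n - k + 1)) / (((((n - k : ℕ) : ℝ)) + 1) * r)) ≤
      (1 - 1 / (8 * ((n : ℝ) + 1))) * (M * (t + ε) * ((Nat.factorial n : ℝ) * R ^ n / ((n : ℝ) + 1) ^ 2)) := by
  have hD : 0 < D := by linarith
  have hMpos : 0 < M := by rw [hM]; positivity
  have hRgR : Rg ≤ R := by
    rw [hR]
    have : 0 ≤ 4 * t * D * Cf * Rf := by positivity
    nlinarith
  have hRpos : 0 < R := lt_of_lt_of_le hRg hRgR
  have hR2 : R ≤ 2 * Rg := by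
    rw [hR]
    have : 4 * t * D * Cf * Rf ≤ 1 := by nlinarith
    nlinarith
  have hRfR : Rf ≤ R := hRfg.trans hRgR
  have htε : 0 ≤ t + ε := by linarith
  -- the common scale `X = M (t+ε) n! Rⁿ/(n+1)²`
  obtain ⟨X, hX⟩ : ∃ X : ℝ, X = M * (t + ε) * ((Nat.factorial n : ℝ) * R ^ n / ((n : ℝ) + 1) ^ 2) := ⟨_, rfl⟩
  have hXpos : 0 < X := by rw [hX]; positivity
  rw [← hX]
  -- (1) the `g`-term
  have h1 : Cg * ((Nat.factorial n : ℝ) * Rg ^ n) / ((n : ℝ) + 1) ^ 2 * t ≤ 1 / 8 * X := by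
    have hCgM : Cg ≤ M / 8 := by
      rw [hM]
      have : Cg * 1 ≤ Cg * D := mul_le_mul_of_nonneg_left hD1 hCg.le
      linarith
    have e : 1 / 8 * X = M / 8 * ((Nat.factorial n : ℝ) * R ^ n) / ((n : ℝ) + 1) ^ 2 * (t + ε) := by
      rw [hX]; ring
    rw [e]
    gcongr
    · linarith
  -- (2) split off `k = 0` and rewrite every term through `bootstrap_term_le`
  obtain ⟨m, rfl⟩ : ∃ m, n = m + 1 := ⟨n - 1, by omega⟩
  rw [Finset.mul_sum, Finset.sum_range_succ']
  -- the `k = 0` term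
  have h2 : D * ((Nat.choose (m + 1) (0 + 1) : ℝ) *
        (Cf * (((Nat.factorial (0 + 1) : ℕ) : ℝ) * Rf ^ (0 + 1)) / ((((0 + 1 : ℕ) : ℝ)) + 1) ^ 2) * (M * (t + ε)) *
        ((((Nat.factorial (m + 1 - 0) : ℕ) : ℝ)) / ((((m + 1 - 0 : ℕ) : ℝ)) + 1) ^ 2) *
        ((R ^ (m + 1 - 0 + 1) - Rg ^ (m + 1 - 0 + 1)) / (((((m + 1 - 0 : ℕ) : ℝ)) + 1) * r))) ≤
      ((m : ℝ) + 1) / (8 * (((m + 1 : ℕ) : ℝ) + 1)) * X := by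
    have hb := bootstrap_term_le (n := m + 1) (k := 0) (j := m) (by omega) hD hCf hRf hRg hMpos.le htε
      (R := R)
    rw [show m + 1 - 0 = m + 1 by omega, hr]
    refine hb.trans ?_
    rw [hX, pow_zero, mul_one, div_le_iff₀ (by positivity)]
    push_cast
    have e : ((m : ℝ) + 1) / (8 * ((m : ℝ) + 1 + 1)) *
          (M * (t + ε) * ((Nat.factorial (m + 1) : ℝ) * R ^ (m + 1) / ((m : ℝ) + 1 + 1) ^ 2)) *
          (4 * Rg * ((0 : ℝ) + 2) ^ 2 * ((m : ℝ) + 2) ^ 3) =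
        M * (t + ε) * (Nat.factorial (m + 1) : ℝ) * ((m : ℝ) + 1) * R ^ (m + 1) * (2 * Rg) *
          (((m : ℝ) + 2) ^ 3 / ((m : ℝ) + 1 + 1) ^ 3) := by
      field_simp
      ring
    rw [e, show ((m : ℝ) + 2) ^ 3 / ((m : ℝ) + 1 + 1) ^ 3 = 1 by rw [show (m : ℝ) + 1 + 1 = (m : ℝ) + 2 by ring]; field_simp,
      mul_one, pow_succ]
    have hpre : 0 ≤ M * (t + ε) * (Nat.factorial (m + 1) : ℝ) * ((m : ℝ) + 1) * R ^ (m + 1) := by positivity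
    calc M * (t + ε) * (Nat.factorial (m + 1) : ℝ) * ((m : ℝ) + 1) * (R ^ (m + 1) * R)
        = M * (t + ε) * (Nat.factorial (m + 1) : ℝ) * ((m : ℝ) + 1) * R ^ (m + 1) * R := by ring
      _ ≤ M * (t + ε) * (Nat.factorial (m + 1) : ℝ) * ((m : ℝ) + 1) * R ^ (m + 1) * (2 * Rg) :=
          mul_le_mul_of_nonneg_left hR2 hpre
  -- the `k ≥ 1` terms
  have h3 : ∀ k ∈ Finset.range m, D * ((Nat.choose (m + 1) (k + 1 + 1) : ℝ) *
        (Cf * (((Nat.factorial (k + 1 + 1) : ℕ) : ℝ) * Rf ^ (k + 1 + 1)) / ((((k + 1 + 1 : ℕ) : ℝ)) + 1) ^ 2) *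
        (M * (t + ε)) *
        ((((Nat.factorial (m + 1 - (k + 1)) : ℕ) : ℝ)) / ((((m + 1 - (k + 1) : ℕ) : ℝ)) + 1) ^ 2) *
        ((R ^ (m + 1 - (k + 1) + 1) - Rg ^ (m + 1 - (k + 1) + 1)) / (((((m + 1 - (k + 1) : ℕ) : ℝ)) + 1) * r))) ≤
      X / 4 * ((((m + 1 : ℕ) : ℝ) + 1) ^ 2 / (((k : ℝ) + 3) ^ 2 * ((((m + 1 : ℕ) : ℝ)) - k) ^ 2)) := by
    intro k hk
    have hkm : k < m := Finset.mem_range.1 hk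
    obtain ⟨j, hj⟩ : ∃ j, k + 1 + 1 + j = m + 1 := ⟨m - k - 1, by omega⟩
    have hb := bootstrap_term_le (n := m + 1) (k := k + 1) (j := j) hj hD hCf hRf hRg hMpos.le htε
      (R := R)
    rw [show m + 1 - (k + 1) = j + 1 by omega, hr]
    refine hb.trans ?_
    rw [hX]
    push_cast
    have ej : (m : ℝ) + 1 - k = (j : ℝ) + 2 := by
      have : ((k + 1 + 1 + j : ℕ) : ℝ) = ((m + 1 : ℕ) : ℝ) := by rw [hj]
      push_cast at this
      linarith
    rw [ej, div_le_iff₀ (by positivity)]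
    have e : (M * (t + ε) * ((Nat.factorial (m + 1) : ℝ) * R ^ (m + 1) / ((m : ℝ) + 1 + 1) ^ 2)) / 4 *
          (((m : ℝ) + 1 + 1) ^ 2 / (((k : ℝ) + 3) ^ 2 * ((j : ℝ) + 2) ^ 2)) *
          (4 * Rg * ((k : ℝ) + 1 + 2) ^ 2 * ((j : ℝ) + 2) ^ 3) =
        M * (t + ε) * (Nat.factorial (m + 1) : ℝ) * R ^ (m + 1) * Rg * ((j : ℝ) + 2) *
          (((k : ℝ) + 1 + 2) ^ 2 / ((k : ℝ) + 3) ^ 2) := by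
      field_simp
    rw [e, show ((k : ℝ) + 1 + 2) ^ 2 / ((k : ℝ) + 3) ^ 2 = 1 by
      rw [show (k : ℝ) + 1 + 2 = (k : ℝ) + 3 by ring]; field_simp, mul_one]
    -- `(j+1) R_f^{k+1} R^{j+2} ≤ R^{m+1} R_g (j+2)` from `R_f ≤ R_g`, `R_f ≤ R`, `m + 1 = k + 2 + j`
    have hpow : Rf ^ (k + 1) * R ^ (j + 2) ≤ R ^ (m + 1) * Rg := by
      have e1 : R ^ (m + 1) * Rg = (R ^ k * R ^ (j + 2)) * Rg := by
        rw [← pow_add, show k + (j + 2) = m + 1 by omega]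
      rw [e1, pow_succ]
      have h4 : Rf ^ k ≤ R ^ k := pow_le_pow_left₀ hRf.le hRfR k
      have h5 : 0 ≤ R ^ (j + 2) := pow_nonneg hRpos.le _
      calc Rf ^ k * Rf * R ^ (j + 2) = (Rf ^ k * R ^ (j + 2)) * Rf := by ring
        _ ≤ (R ^ k * R ^ (j + 2)) * Rg :=
            mul_le_mul (mul_le_mul_of_nonneg_right h4 h5) hRfg hRf.le (by positivity)
    have hpre : 0 ≤ M * (t + ε) * (Nat.factorial (m + 1) : ℝ) := by positivity
    have hj1 : (j : ℝ) + 1 ≤ (j : ℝ) + 2 := by linarith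
    calc M * (t + ε) * (Nat.factorial (m + 1) : ℝ) * ((j : ℝ) + 1) * Rf ^ (k + 1) * R ^ (j + 2)
        = M * (t + ε) * (Nat.factorial (m + 1) : ℝ) * (((j : ℝ) + 1) * (Rf ^ (k + 1) * R ^ (j + 2))) := by ring
      _ ≤ M * (t + ε) * (Nat.factorial (m + 1) : ℝ) * (((j : ℝ) + 2) * (R ^ (m + 1) * Rg)) :=
          mul_le_mul_of_nonneg_left (mul_le_mul hj1 hpow (by positivity) (by positivity)) hpre
      _ = M * (t + ε) * (Nat.factorial (m + 1) : ℝ) * R ^ (m + 1) * Rg * ((j : ℝ) + 2) := by ring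
  have h3sum := Finset.sum_le_sum h3
  have hfac : ∑ k ∈ Finset.range m, X / 4 * ((((m + 1 : ℕ) : ℝ) + 1) ^ 2 /
      (((k : ℝ) + 3) ^ 2 * ((((m + 1 : ℕ) : ℝ)) - k) ^ 2)) = X / 4 * ∑ k ∈ Finset.range m,
      ((((m + 1 : ℕ) : ℝ) + 1) ^ 2 / (((k : ℝ) + 3) ^ 2 * ((((m + 1 : ℕ) : ℝ)) - k) ^ 2)) := by
    rw [Finset.mul_sum]
  rw [hfac] at h3sum
  have hw := sum_weight_lowerOrder_le_three (m + 1)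
  rw [show m + 1 - 1 = m by omega] at hw
  -- assemble: `1/8 + 3/4 + (m+1)/(8(m+2)) = 1 - 1/(8(m+2))`
  have hw' : X / 4 * (∑ k ∈ Finset.range m,
      (((m + 1 : ℕ) : ℝ) + 1) ^ 2 / (((k : ℝ) + 3) ^ 2 * ((((m + 1 : ℕ) : ℝ)) - k) ^ 2)) ≤ 3 / 4 * X := by
    have := mul_le_mul_of_nonneg_left hw (show 0 ≤ X / 4 by positivity)
    linarith
  have e : (1 - 1 / (8 * (((m + 1 : ℕ) : ℝ) + 1))) * X =
      1 / 8 * X + (3 / 4 * X + ((m : ℝ) + 1) / (8 * (((m + 1 : ℕ) : ℝ) + 1)) * X) := by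
    push_cast
    field_simp
    ring
  rw [e]
  exact add_le_add h1 (add_le_add (h3sum.trans hw') h2)

end Budget

section Pass

/-- **One bootstrap pass** (the inductive step of Armstrong–Vicol's proof of Lemma 7.7, p. 72, in
barrier form): on the slab `[0,T₀]`, `T₀ ≤ T = 1/(4DC_fR_f)` (`D ≥ d`), if the bounds
`derivSup j (Y s) ≤ M (s+ε) j! R(s)ʲ/(j+1)²` (`R(s) = R_g(1 + 4sDC_fR_f)`, `M = 8DC_g`) hold for all
orders `1 ≤ j ≤ n` and all `s ∈ [0,t₁]`, then at `t₁` the order-`n` bound holds with the factor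
`1 − 1/(8(n+1)) < 1`. Each `∂^l Y` (`|l| = n`) is transported with source `∂^l g − [∂^l, f·∇]Y`
(`transport_iterPartialDeriv`); BDSV's sup-norm estimate along characteristics
(`Literature.Analysis.ODE.norm_le_of_transport`) with the explicit polynomial majorant, integrated in
closed form (`hasDerivAt_radius_pow` and the fundamental theorem of calculus), and `bootstrap_budget_le`.
[cite: ArmstrongVicol2025, App. A Lemma 7.7 (proof, p. 72)] -/
theorem bootstrap_pass {T₀ : ℝ} {f : ℝ → UnitAddTorus d → EuclideanSpace ℝ d} {Y g : ℝ → UnitAddTorus d → ℝ}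
    (hf : IsSmoothSpaceTimeOn (Icc 0 T₀) f) (hY : IsSmoothSpaceTimeOn (Icc 0 T₀) Y)
    (hg : IsSmoothSpaceTimeOn (Icc 0 T₀) g) (hY0 : ∀ x, Y 0 x = 0)
    (heq : ∀ t ∈ Icc 0 T₀, ∀ x, timeDerivWithin (Icc 0 T₀) Y t x + convect (f t) (Y t) x = g t x)
    {D Cf Rf Cg Rg : ℝ} (hDd : (Fintype.card d : ℝ) ≤ D) (hD1 : 1 ≤ D) (hCf : 0 < Cf) (hRf : 0 < Rf)
    (hCg : 0 < Cg) (hRg : 0 < Rg) (hRfg : Rf ≤ Rg) (hT₀T : T₀ * (4 * D * Cf * Rf) ≤ 1)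
    {n : ℕ} (hn : 1 ≤ n) (hfb : ∀ m, 1 ≤ m → m ≤ n → ∀ t ∈ Icc 0 T₀, dnorm m Rf (f t) ≤ Cf)
    (hgb : ∀ t ∈ Icc 0 T₀, dnorm n Rg (g t) ≤ Cg) {ε : ℝ} (hε : 0 < ε) {t₁ : ℝ} (ht₁ : t₁ ∈ Icc 0 T₀)
    (hboot : ∀ j, 1 ≤ j → j ≤ n → ∀ s ∈ Icc 0 t₁, derivSup j (Y s) ≤
      8 * D * Cg * (s + ε) * ((Nat.factorial j : ℝ) * (Rg * (1 + 4 * s * D * Cf * Rf)) ^ j / ((j : ℝ) + 1) ^ 2)) :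
    derivSup n (Y t₁) ≤ (1 - 1 / (8 * ((n : ℝ) + 1))) *
      (8 * D * Cg * (t₁ + ε) * ((Nat.factorial n : ℝ) * (Rg * (1 + 4 * t₁ * D * Cf * Rf)) ^ n / ((n : ℝ) + 1) ^ 2)) := by
  have hD : 0 < D := by linarith
  obtain ⟨M, hM⟩ : ∃ M : ℝ, M = 8 * D * Cg := ⟨_, rfl⟩
  obtain ⟨r, hr⟩ : ∃ r : ℝ, r = 4 * D * Cf * Rf * Rg := ⟨_, rfl⟩
  have hMpos : 0 < M := by rw [hM]; positivity
  have hrpos : 0 < r := by rw [hr]; positivity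
  have hrR : ∀ s, Rg * (1 + 4 * s * D * Cf * Rf) = Rg + r * s := fun s => by rw [hr]; ring
  rw [← hM]
  have hfact : (0 : ℝ) < 1 - 1 / (8 * ((n : ℝ) + 1)) := by
    have h8 : (1 : ℝ) < 8 * ((n : ℝ) + 1) := by
      have : (0 : ℝ) ≤ n := Nat.cast_nonneg n
      linarith
    have : 1 / (8 * ((n : ℝ) + 1)) < 1 := (div_lt_one (by linarith)).2 h8
    linarith
  rcases ht₁.1.eq_or_lt with h0 | ht₁pos
  · -- `t₁ = 0`: `Y(0) = 0`
    subst h0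
    have hY0' : Y 0 = fun _ => (0 : ℝ) := funext hY0
    rw [hY0', derivSup_zero_fun]
    have : 0 ≤ M * (0 + ε) * ((Nat.factorial n : ℝ) * (Rg * (1 + 4 * 0 * D * Cf * Rf)) ^ n / ((n : ℝ) + 1) ^ 2) := by
      have : 0 ≤ Rg * (1 + 4 * 0 * D * Cf * Rf) := by simp [hRg.le]
      positivity
    exact mul_nonneg hfact.le this
  -- the slab `[0,t₁]`
  have hsub : Icc 0 t₁ ⊆ Icc 0 T₀ := Icc_subset_Icc le_rfl ht₁.2
  have hS₁ : UniqueDiffOn ℝ (Icc 0 t₁) := uniqueDiffOn_Icc ht₁pos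
  have hf₁ := hf.mono hsub
  have hY₁ := hY.mono hsub
  have hg₁ := hg.mono hsub
  have heq₁ : ∀ t ∈ Icc 0 t₁, ∀ x, timeDerivWithin (Icc 0 t₁) Y t x + convect (f t) (Y t) x = g t x := by
    intro t ht x
    rw [timeDerivWithin_eq_of_subset' hY hsub hS₁ ht x]
    exact heq t (hsub ht) x
  have ht₁T : t₁ * (4 * D * Cf * Rf) ≤ 1 :=
    (mul_le_mul_of_nonneg_right ht₁.2 (by positivity)).trans hT₀T
  -- the coefficients of the majorant, the majorant `Gb` and its antiderivative `Φ`
  obtain ⟨κ, hκ⟩ : ∃ κ : ℕ → ℝ, κ = fun k => (n.choose (k + 1) : ℝ) *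
      (Cf * (((Nat.factorial (k + 1) : ℕ) : ℝ) * Rf ^ (k + 1)) / ((((k + 1 : ℕ) : ℝ)) + 1) ^ 2) * (M * (t₁ + ε)) *
      ((((Nat.factorial (n - k) : ℕ) : ℝ)) / ((((n - k : ℕ) : ℝ)) + 1) ^ 2) := ⟨_, rfl⟩
  have hκ0 : ∀ k, 0 ≤ κ k := fun k => by
    rw [hκ]
    have : 0 ≤ t₁ + ε := by linarith [ht₁.1]
    positivity
  obtain ⟨Gn, hGn⟩ : ∃ Gn : ℝ, Gn = Cg * ((Nat.factorial n : ℝ) * Rg ^ n) / ((n : ℝ) + 1) ^ 2 := ⟨_, rfl⟩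
  have hGn0 : 0 ≤ Gn := by rw [hGn]; positivity
  obtain ⟨Gb, hGb⟩ : ∃ Gb : ℝ → ℝ, Gb = fun s => Gn + D * ∑ k ∈ Finset.range n, κ k * (Rg + r * s) ^ (n - k) :=
    ⟨_, rfl⟩
  obtain ⟨Φ, hΦ⟩ : ∃ Φ : ℝ → ℝ, Φ = fun s => Gn * s +
      D * ∑ k ∈ Finset.range n, κ k * ((Rg + r * s) ^ (n - k + 1) / ((((n - k : ℕ) : ℝ) + 1) * r)) := ⟨_, rfl⟩
  have hderiv : ∀ s, HasDerivAt Φ (Gb s) s := by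
    intro s
    rw [hΦ, hGb]
    have h1 : HasDerivAt (fun s => Gn * s) Gn s := by simpa using (hasDerivAt_id s).const_mul Gn
    have h2 : HasDerivAt (fun s => ∑ k ∈ Finset.range n, κ k * ((Rg + r * s) ^ (n - k + 1) / ((((n - k : ℕ) : ℝ) + 1) * r)))
        (∑ k ∈ Finset.range n, κ k * (Rg + r * s) ^ (n - k)) s :=
      HasDerivAt.fun_sum fun k _ => (hasDerivAt_radius_pow Rg r hrpos.ne' (n - k) s).const_mul (κ k)
    exact h1.fun_add (h2.const_mul D)
  have hGbc : Continuous Gb := by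
    rw [hGb]
    fun_prop
  have hGb0 : ∀ s, 0 ≤ s → 0 ≤ Gb s := fun s hs => by
    rw [hGb]
    have : 0 ≤ Rg + r * s := by positivity
    exact add_nonneg hGn0 (mul_nonneg hD.le (Finset.sum_nonneg fun k _ => mul_nonneg (hκ0 k) (pow_nonneg this _)))
  -- the integral of the majorant and its budget
  have hint : ∫ s in (0 : ℝ)..t₁, Gb s = Φ t₁ - Φ 0 :=
    intervalIntegral.integral_eq_sub_of_hasDerivAt (fun s _ => hderiv s) (hGbc.intervalIntegrable 0 t₁)
  have hint0 : 0 ≤ ∫ s in (0 : ℝ)..t₁, Gb s :=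
    intervalIntegral.integral_nonneg ht₁.1 fun s hs => hGb0 s hs.1
  have hΦdiff : Φ t₁ - Φ 0 = Gn * t₁ + D * ∑ k ∈ Finset.range n, κ k *
      (((Rg + r * t₁) ^ (n - k + 1) - Rg ^ (n - k + 1)) / ((((n - k : ℕ) : ℝ) + 1) * r)) := by
    rw [hΦ]
    simp only [mul_zero, add_zero, zero_add]
    rw [add_sub_assoc, ← mul_sub, ← Finset.sum_sub_distrib]
    congr 2
    refine Finset.sum_congr rfl fun k _ => ?_
    rw [sub_div, mul_sub]
  have hbudget : Φ t₁ - Φ 0 ≤ (1 - 1 / (8 * ((n : ℝ) + 1))) *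
      (M * (t₁ + ε) * ((Nat.factorial n : ℝ) * (Rg + r * t₁) ^ n / ((n : ℝ) + 1) ^ 2)) := by
    rw [hΦdiff, hGn]
    have hb := bootstrap_budget_le hn hD1 hCf hRf hCg hRg hRfg ht₁.1 ht₁T hε ((hrR t₁).symm) hr hM
    simp only [hκ] at hb ⊢
    exact hb
  -- the transport estimate for each `∂^l Y`, `|l| = n`
  have hpt : ∀ l : List d, l.length = n → ∀ y, ‖iterPartialDeriv l (Y t₁) y‖ ≤ Φ t₁ - Φ 0 := by
    intro l hl y
    have hl0 : l ≠ [] := by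
      intro h
      rw [h, List.length_nil] at hl
      omega
    have hZ : IsSmoothSpaceTimeOn (Icc 0 t₁) (fun s => iterPartialDeriv l (Y s)) := hY₁.iterPartialDeriv hS₁ l
    have hH : IsSmoothSpaceTimeOn (Icc 0 t₁) (fun s x => iterPartialDeriv l (g s) x -
        (iterPartialDeriv l (convect (f s) (Y s)) x - convect (f s) (iterPartialDeriv l (Y s)) x)) :=
      (hg₁.iterPartialDeriv hS₁ l).sub (((hf₁.convect hY₁ hS₁).iterPartialDeriv hS₁ l).sub (hf₁.convect hZ hS₁))
    have heqZ : ∀ t ∈ Icc 0 t₁, ∀ x, timeDerivWithin (Icc 0 t₁) (fun s => iterPartialDeriv l (Y s)) t x +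
        convect (f t) (iterPartialDeriv l (Y t)) x = iterPartialDeriv l (g t) x -
          (iterPartialDeriv l (convect (f t) (Y t)) x - convect (f t) (iterPartialDeriv l (Y t)) x) :=
      fun t ht x => transport_iterPartialDeriv ht₁pos hf₁ hY₁ hg₁ heq₁ l ht x
    have hB₀ : ∀ x, ‖iterPartialDeriv l (Y 0) x‖ ≤ 0 := by
      intro x
      have hY0' : Y 0 = fun _ => (0 : ℝ) := funext hY0
      rw [hY0', iterPartialDeriv_const (0 : ℝ) l hl0]
      simp
    -- the pointwise majorant
    have hmaj : ∀ s ∈ Icc 0 t₁, ∀ x, ‖iterPartialDeriv l (g s) x -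
        (iterPartialDeriv l (convect (f s) (Y s)) x - convect (f s) (iterPartialDeriv l (Y s)) x)‖ ≤ Gb s := by
      intro s hs x
      have hsT : s ∈ Icc 0 T₀ := hsub hs
      have hfs : IsSmooth (f s) := hf.isSmooth_slice hsT
      have hYs : IsSmooth (Y s) := hY.isSmooth_slice hsT
      have hgs : IsSmooth (g s) := hg.isSmooth_slice hsT
      have e1 : ‖iterPartialDeriv l (g s) x‖ ≤ Gn := by
        rw [hGn]
        exact norm_iterPartialDeriv_le_of_dnorm_le hgs hRg (hgb s hsT) hl x
      have e2 := abs_iterPartialDeriv_convect_sub_le hfs hYs hl x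
      -- termwise: `derivSup (k+1) (f s) ≤ Fb`, `derivSup (n-k) (Y s) ≤ M (t₁+ε) ρ`
      have e3 : ∀ k ∈ Finset.range n, (n.choose (k + 1) : ℝ) * (derivSup (k + 1) (f s) * derivSup (n - k) (Y s)) ≤
          κ k * (Rg + r * s) ^ (n - k) := by
        intro k hk
        have hkn : k < n := Finset.mem_range.1 hk
        have hF := derivSup_le_of_dnorm_le hfs hRf (hfb (k + 1) (by omega) (by omega) s hsT)
        have hB := hboot (n - k) (by omega) (by omega) s hs
        rw [← hM, hrR s] at hB
        have hB' : derivSup (n - k) (Y s) ≤ M * (t₁ + ε) *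
            ((Nat.factorial (n - k) : ℝ) * (Rg + r * s) ^ (n - k) / ((((n - k : ℕ) : ℝ)) + 1) ^ 2) := by
          refine hB.trans ?_
          have hRs : 0 ≤ Rg + r * s := by have := hs.1; positivity
          have : M * (s + ε) ≤ M * (t₁ + ε) := mul_le_mul_of_nonneg_left (by linarith [hs.2]) hMpos.le
          exact mul_le_mul_of_nonneg_right this (by positivity)
        have hprod := mul_le_mul hF hB' (derivSup_nonneg _ _)
          (by have := (dnorm_nonneg (k + 1) hRf.le (f s)).trans (hfb (k + 1) (by omega) (by omega) s hsT); positivity)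
        refine (mul_le_mul_of_nonneg_left hprod (Nat.cast_nonneg _)).trans (le_of_eq ?_)
        rw [hκ]
        push_cast
        ring
      have e4 : (Fintype.card d : ℝ) * ∑ k ∈ Finset.range n,
          (n.choose (k + 1) : ℝ) * (derivSup (k + 1) (f s) * derivSup (n - k) (Y s)) ≤
          D * ∑ k ∈ Finset.range n, κ k * (Rg + r * s) ^ (n - k) := by
        have hsum0 : 0 ≤ ∑ k ∈ Finset.range n,
            (n.choose (k + 1) : ℝ) * (derivSup (k + 1) (f s) * derivSup (n - k) (Y s)) :=
          Finset.sum_nonneg fun k _ => mul_nonneg (Nat.cast_nonneg _)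
            (mul_nonneg (derivSup_nonneg _ _) (derivSup_nonneg _ _))
        exact mul_le_mul hDd (Finset.sum_le_sum e3) hsum0 hD.le
      rw [hGb]
      calc ‖iterPartialDeriv l (g s) x -
            (iterPartialDeriv l (convect (f s) (Y s)) x - convect (f s) (iterPartialDeriv l (Y s)) x)‖
          ≤ ‖iterPartialDeriv l (g s) x‖ +
            ‖iterPartialDeriv l (convect (f s) (Y s)) x - convect (f s) (iterPartialDeriv l (Y s)) x‖ := norm_sub_le _ _
        _ ≤ Gn + D * ∑ k ∈ Finset.range n, κ k * (Rg + r * s) ^ (n - k) := by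
            refine add_le_add e1 ?_
            rw [Real.norm_eq_abs]
            exact e2.trans e4
    have key := Literature.Analysis.ODE.norm_le_of_transport ht₁pos hf₁ hZ hH heqZ
      (left_mem_Icc.2 ht₁pos.le) (right_mem_Icc.2 ht₁pos.le) hB₀ hGbc.continuousOn hmaj y
    rw [zero_add, hint, abs_of_nonneg (hint ▸ hint0)] at key
    exact key
  -- conclusion
  have hfin : derivSup n (Y t₁) ≤ Φ t₁ - Φ 0 := derivSup_le (hint ▸ hint0) hpt
  rw [hrR t₁]
  exact hfin.trans hbudget

end Pass

section Continuation

/-- **Continuation in time** (closing the inductive step): given the bounds of all lower orders on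
the whole slab, the order-`n` bound `derivSup n (Y t) ≤ M t n! R(t)ⁿ/(n+1)²` holds on `[0,T₀]`.
For each `ε > 0` the barrier `M (t+ε) n! R(t)ⁿ/(n+1)²` is propagated in steps of length
`h = gap/(L+1)`, `L` the a priori time-Lipschitz constant of the order-`n` derivatives
(`exists_derivSup_sub_le`) and `gap = M ε n! R_gⁿ/(8(n+1)³)` the room left by `bootstrap_pass`;
then `ε → 0`. [cite: ArmstrongVicol2025, App. A Lemma 7.7 (proof, p. 72, "taking the supremum over t")] -/
theorem bootstrap_order {T₀ : ℝ} {f : ℝ → UnitAddTorus d → EuclideanSpace ℝ d} {Y g : ℝ → UnitAddTorus d → ℝ}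
    (hf : IsSmoothSpaceTimeOn (Icc 0 T₀) f) (hY : IsSmoothSpaceTimeOn (Icc 0 T₀) Y)
    (hg : IsSmoothSpaceTimeOn (Icc 0 T₀) g) (hY0 : ∀ x, Y 0 x = 0)
    (heq : ∀ t ∈ Icc 0 T₀, ∀ x, timeDerivWithin (Icc 0 T₀) Y t x + convect (f t) (Y t) x = g t x)
    {D Cf Rf Cg Rg : ℝ} (hDd : (Fintype.card d : ℝ) ≤ D) (hD1 : 1 ≤ D) (hCf : 0 < Cf) (hRf : 0 < Rf)
    (hCg : 0 < Cg) (hRg : 0 < Rg) (hRfg : Rf ≤ Rg) (hT₀T : T₀ * (4 * D * Cf * Rf) ≤ 1)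
    {n : ℕ} (hn : 1 ≤ n) (hfb : ∀ m, 1 ≤ m → m ≤ n → ∀ t ∈ Icc 0 T₀, dnorm m Rf (f t) ≤ Cf)
    (hgb : ∀ t ∈ Icc 0 T₀, dnorm n Rg (g t) ≤ Cg)
    (hIH : ∀ j, 1 ≤ j → j < n → ∀ s ∈ Icc 0 T₀, derivSup j (Y s) ≤
      8 * D * Cg * s * ((Nat.factorial j : ℝ) * (Rg * (1 + 4 * s * D * Cf * Rf)) ^ j / ((j : ℝ) + 1) ^ 2))
    {t : ℝ} (ht : t ∈ Icc 0 T₀) :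
    derivSup n (Y t) ≤
      8 * D * Cg * t * ((Nat.factorial n : ℝ) * (Rg * (1 + 4 * t * D * Cf * Rf)) ^ n / ((n : ℝ) + 1) ^ 2) := by
  have hD : 0 < D := by linarith
  -- abbreviations: `M`, the weight `ρ s = n! R(s)ⁿ/(n+1)²`
  obtain ⟨M, hM⟩ : ∃ M : ℝ, M = 8 * D * Cg := ⟨_, rfl⟩
  have hMpos : 0 < M := by rw [hM]; positivity
  obtain ⟨ρ, hρ⟩ : ∃ ρ : ℝ → ℝ, ρ = fun s =>
      (Nat.factorial n : ℝ) * (Rg * (1 + 4 * s * D * Cf * Rf)) ^ n / ((n : ℝ) + 1) ^ 2 := ⟨_, rfl⟩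
  have hρpos : ∀ s, 0 ≤ s → 0 < ρ s := fun s hs => by
    rw [hρ]
    have : 0 < Rg * (1 + 4 * s * D * Cf * Rf) := by positivity
    positivity
  have hρmono : ∀ s s', 0 ≤ s → s ≤ s' → ρ s ≤ ρ s' := fun s s' hs hss' => by
    simp only [hρ]
    have h1 : Rg * (1 + 4 * s * D * Cf * Rf) ≤ Rg * (1 + 4 * s' * D * Cf * Rf) := by
      have : 4 * s * D * Cf * Rf ≤ 4 * s' * D * Cf * Rf := by gcongr
      nlinarith
    have h0 : 0 ≤ Rg * (1 + 4 * s * D * Cf * Rf) := by positivity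
    have := pow_le_pow_left₀ h0 h1 n
    exact div_le_div_of_nonneg_right (mul_le_mul_of_nonneg_left this (Nat.cast_nonneg _)) (by positivity)
  rw [← hM, show (Nat.factorial n : ℝ) * (Rg * (1 + 4 * t * D * Cf * Rf)) ^ n / ((n : ℝ) + 1) ^ 2 = ρ t by rw [hρ]]
  have hY00 : derivSup n (Y 0) = 0 := by
    rw [show Y 0 = fun _ => (0 : ℝ) from funext hY0, derivSup_zero_fun]
  -- the degenerate slab
  rcases ht.1.eq_or_lt with h0 | htpos
  · subst h0
    rw [hY00]
    simp
  have hT₀ : 0 < T₀ := lt_of_lt_of_le htpos ht.2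
  -- the barrier statement for every `ε > 0`
  have hbar : ∀ ε : ℝ, 0 < ε → ∀ s ∈ Icc 0 T₀, derivSup n (Y s) ≤ M * (s + ε) * ρ s := by
    intro ε hε
    obtain ⟨L, hL0, hL⟩ := exists_derivSup_sub_le hT₀ hY n
    -- the gap left by one pass, and the step
    obtain ⟨gap, hgap⟩ : ∃ gap : ℝ, gap = 1 / (8 * ((n : ℝ) + 1)) * (M * ε * ρ 0) := ⟨_, rfl⟩
    have hgappos : 0 < gap := by
      rw [hgap]
      have := hρpos 0 le_rfl
      positivity
    obtain ⟨h, hh⟩ : ∃ h : ℝ, h = gap / (L + 1) := ⟨_, rfl⟩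
    have hhpos : 0 < h := by rw [hh]; positivity
    have hLh : L * h ≤ gap := by
      rw [hh, mul_div_assoc']
      rw [div_le_iff₀ (by linarith)]
      nlinarith
    -- induction over the steps
    have hstep : ∀ k : ℕ, ∀ s ∈ Icc 0 T₀, s ≤ k * h → derivSup n (Y s) ≤ M * (s + ε) * ρ s := by
      intro k
      induction k with
      | zero =>
        intro s hs hsk
        have hs0 : s = 0 := le_antisymm (by simpa using hsk) hs.1
        subst hs0
        rw [hY00]
        exact mul_nonneg (mul_nonneg hMpos.le (by linarith)) (hρpos 0 le_rfl).le
      | succ k ih =>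
        intro s hs hsk
        by_cases hsk' : s ≤ k * h
        · exact ih s hs hsk'
        push Not at hsk'
        -- the base point `s₀ = k h ∈ [0, s)`
        have hs₀0 : (0 : ℝ) ≤ k * h := by positivity
        have hs₀T : (k : ℝ) * h ∈ Icc 0 T₀ := ⟨hs₀0, (hsk'.le.trans hs.2)⟩
        have hpass := bootstrap_pass hf hY hg hY0 heq hDd hD1 hCf hRf hCg hRg hRfg hT₀T hn hfb hgb hε hs₀T
          (fun j hj1 hjn u hu => by
            rcases Nat.lt_or_ge j n with hjlt | hjge
            · refine (hIH j hj1 hjlt u ⟨hu.1, hu.2.trans hs₀T.2⟩).trans ?_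
              have hρj : 0 ≤ (Nat.factorial j : ℝ) * (Rg * (1 + 4 * u * D * Cf * Rf)) ^ j / ((j : ℝ) + 1) ^ 2 := by
                have : 0 ≤ Rg * (1 + 4 * u * D * Cf * Rf) := by have := hu.1; positivity
                positivity
              have : 8 * D * Cg * u ≤ 8 * D * Cg * (u + ε) := by
                rw [← hM]; exact mul_le_mul_of_nonneg_left (by linarith) hMpos.le
              exact mul_le_mul_of_nonneg_right this hρj
            · have hjn' : j = n := le_antisymm hjn hjge
              subst hjn'
              have := ih u ⟨hu.1, hu.2.trans hs₀T.2⟩ hu.2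
              rw [hM, hρ] at this
              exact this)
        rw [← hM, show (Nat.factorial n : ℝ) * (Rg * (1 + 4 * (k * h) * D * Cf * Rf)) ^ n / ((n : ℝ) + 1) ^ 2 =
          ρ (k * h) by rw [hρ]] at hpass
        -- Lipschitz step from `s₀` to `s`
        have hlip := hL ((k : ℝ) * h) hs₀T s hs
        have hdist : |s - k * h| ≤ h := by
          rw [abs_of_pos (by linarith)]
          push_cast at hsk
          linarith
        have hρ0 : ε * ρ 0 ≤ (k * h + ε) * ρ (k * h) :=
          mul_le_mul (by linarith) (hρmono 0 _ le_rfl hs₀0) (hρpos 0 le_rfl).le (by linarith)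
        have hgap' : gap ≤ 1 / (8 * ((n : ℝ) + 1)) * (M * (k * h + ε) * ρ (k * h)) := by
          rw [hgap]
          refine mul_le_mul_of_nonneg_left ?_ (by positivity)
          calc M * ε * ρ 0 = M * (ε * ρ 0) := by ring
            _ ≤ M * ((k * h + ε) * ρ (k * h)) := mul_le_mul_of_nonneg_left hρ0 hMpos.le
            _ = M * (k * h + ε) * ρ (k * h) := by ring
        have hmono : M * (k * h + ε) * ρ (k * h) ≤ M * (s + ε) * ρ s :=
          mul_le_mul (mul_le_mul_of_nonneg_left (by linarith) hMpos.le) (hρmono _ _ hs₀0 hsk'.le)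
            (hρpos _ hs₀0).le (mul_nonneg hMpos.le (by linarith [hs.1]))
        calc derivSup n (Y s) ≤ derivSup n (Y (k * h)) + L * |s - k * h| := hlip
          _ ≤ (1 - 1 / (8 * ((n : ℝ) + 1))) * (M * (k * h + ε) * ρ (k * h)) + L * h :=
              add_le_add hpass (mul_le_mul_of_nonneg_left hdist hL0)
          _ ≤ (1 - 1 / (8 * ((n : ℝ) + 1))) * (M * (k * h + ε) * ρ (k * h)) + gap := by linarith
          _ ≤ M * (k * h + ε) * ρ (k * h) := by nlinarith
          _ ≤ M * (s + ε) * ρ s := hmono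
    intro s hs
    obtain ⟨k, hk⟩ : ∃ k : ℕ, s ≤ k * h := by
      refine ⟨Nat.ceil (s / h), ?_⟩
      have h1 : s / h ≤ (Nat.ceil (s / h) : ℝ) := Nat.le_ceil _
      rwa [div_le_iff₀ hhpos] at h1
    exact hstep k s hs hk
  -- `ε → 0`
  refine le_of_forall_pos_le_add fun δ hδ => ?_
  have hρt := hρpos t ht.1
  have hb := hbar (δ / (M * ρ t)) (by positivity) t ht
  have e : M * (t + δ / (M * ρ t)) * ρ t = M * t * ρ t + δ := by
    field_simp
  linarith [hb, e]

end Continuation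

/-! ## §5 The corrected Lemma 7.7 on a forward slab (scalar transported quantity) -/

section SlabTheorem

/-- **Armstrong–Vicol's transport estimate, corrected radius, on the forward slab `[0,T₀]`**
(`T₀ ≤ T = 1/(4 D C_f R_f)`, `D ≥ max(d,1)`): for a scalar `Y` with `∂ₜY + (f·∇)Y = g`, `Y(0) = 0`,
all fields jointly smooth on the slab, `⟦f(t)⟧_{m,R_f} ≤ C_f` (`1 ≤ m ≤ N`), `⟦g(t)⟧_{n,R_g} ≤ C_g`
(`1 ≤ n ≤ N`), `R_f ≤ R_g`: for `1 ≤ n ≤ N` and `t ∈ [0,T₀]`,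
`derivSup n (Y t) ≤ 8 D C_g t · n! R(t)ⁿ/(n+1)²`, `R(t) = R_g (1 + 4 t D C_f R_f)`
(strong induction on `n` via `bootstrap_order`). [cite: ArmstrongVicol2025, App. A Lemma 7.7 (p. 72; radius corrected)] -/
theorem derivSup_transport_le_slab {T₀ : ℝ} {f : ℝ → UnitAddTorus d → EuclideanSpace ℝ d}
    {Y g : ℝ → UnitAddTorus d → ℝ}
    (hf : IsSmoothSpaceTimeOn (Icc 0 T₀) f) (hY : IsSmoothSpaceTimeOn (Icc 0 T₀) Y)
    (hg : IsSmoothSpaceTimeOn (Icc 0 T₀) g) (hY0 : ∀ x, Y 0 x = 0)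
    (heq : ∀ t ∈ Icc 0 T₀, ∀ x, timeDerivWithin (Icc 0 T₀) Y t x + convect (f t) (Y t) x = g t x)
    {D Cf Rf Cg Rg : ℝ} (hDd : (Fintype.card d : ℝ) ≤ D) (hD1 : 1 ≤ D) (hCf : 0 < Cf) (hRf : 0 < Rf)
    (hCg : 0 < Cg) (hRg : 0 < Rg) (hRfg : Rf ≤ Rg) (hT₀T : T₀ * (4 * D * Cf * Rf) ≤ 1) {N : ℕ}
    (hfb : ∀ m, 1 ≤ m → m ≤ N → ∀ t ∈ Icc 0 T₀, dnorm m Rf (f t) ≤ Cf)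
    (hgb : ∀ m, 1 ≤ m → m ≤ N → ∀ t ∈ Icc 0 T₀, dnorm m Rg (g t) ≤ Cg) :
    ∀ n, 1 ≤ n → n ≤ N → ∀ t ∈ Icc 0 T₀, derivSup n (Y t) ≤
      8 * D * Cg * t * ((Nat.factorial n : ℝ) * (Rg * (1 + 4 * t * D * Cf * Rf)) ^ n / ((n : ℝ) + 1) ^ 2) := by
  intro n
  induction n using Nat.strong_induction_on with
  | _ n ih =>
    intro hn hnN t ht
    exact bootstrap_order hf hY hg hY0 heq hDd hD1 hCf hRf hCg hRg hRfg hT₀T hn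
      (fun m hm1 hmn s hs => hfb m hm1 (hmn.trans hnN) s hs) (hgb n hn hnN)
      (fun j hj1 hjn s hs => ih j hjn hj1 (le_of_lt (lt_of_lt_of_le hjn hnN)) s hs) ht

/-- **The same in seminorm form**: `⟦Y(t)⟧_{n, R_g(1 + 4tDC_fR_f)} ≤ 8 D C_g t` on the forward slab.
[cite: ArmstrongVicol2025, App. A Lemma 7.7 (p. 72; radius corrected)] -/
theorem dnorm_transport_le_slab {T₀ : ℝ} {f : ℝ → UnitAddTorus d → EuclideanSpace ℝ d}
    {Y g : ℝ → UnitAddTorus d → ℝ}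
    (hf : IsSmoothSpaceTimeOn (Icc 0 T₀) f) (hY : IsSmoothSpaceTimeOn (Icc 0 T₀) Y)
    (hg : IsSmoothSpaceTimeOn (Icc 0 T₀) g) (hY0 : ∀ x, Y 0 x = 0)
    (heq : ∀ t ∈ Icc 0 T₀, ∀ x, timeDerivWithin (Icc 0 T₀) Y t x + convect (f t) (Y t) x = g t x)
    {D Cf Rf Cg Rg : ℝ} (hDd : (Fintype.card d : ℝ) ≤ D) (hD1 : 1 ≤ D) (hCf : 0 < Cf) (hRf : 0 < Rf)
    (hCg : 0 < Cg) (hRg : 0 < Rg) (hRfg : Rf ≤ Rg) (hT₀T : T₀ * (4 * D * Cf * Rf) ≤ 1) {N : ℕ}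
    (hfb : ∀ m, 1 ≤ m → m ≤ N → ∀ t ∈ Icc 0 T₀, dnorm m Rf (f t) ≤ Cf)
    (hgb : ∀ m, 1 ≤ m → m ≤ N → ∀ t ∈ Icc 0 T₀, dnorm m Rg (g t) ≤ Cg)
    {n : ℕ} (hn : 1 ≤ n) (hnN : n ≤ N) {t : ℝ} (ht : t ∈ Icc 0 T₀) :
    dnorm n (Rg * (1 + 4 * t * D * Cf * Rf)) (Y t) ≤ 8 * D * Cg * t := by
  have h := derivSup_transport_le_slab hf hY hg hY0 heq hDd hD1 hCf hRf hCg hRg hRfg hT₀T hfb hgb n hn hnN t ht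
  have hD : 0 < D := by linarith
  have hR : 0 < Rg * (1 + 4 * t * D * Cf * Rf) := by have := ht.1; positivity
  have hw := dnorm_weight_pos n hR
  rw [dnorm_def]
  calc ((n : ℝ) + 1) ^ 2 / ((Nat.factorial n : ℝ) * (Rg * (1 + 4 * t * D * Cf * Rf)) ^ n) * derivSup n (Y t)
      ≤ ((n : ℝ) + 1) ^ 2 / ((Nat.factorial n : ℝ) * (Rg * (1 + 4 * t * D * Cf * Rf)) ^ n) *
          (8 * D * Cg * t * ((Nat.factorial n : ℝ) * (Rg * (1 + 4 * t * D * Cf * Rf)) ^ n / ((n : ℝ) + 1) ^ 2)) :=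
        mul_le_mul_of_nonneg_left h hw.le
    _ = 8 * D * Cg * t := by
        field_simp

end SlabTheorem

/-! ## §6 Packaging: fields on all of `ℝ`, pointwise equation, vector `Y` componentwise, `|t| ≤ T` -/

section Packaging

variable {F : Type*} [NormedAddCommGroup F] [NormedSpace ℝ F]

omit [DecidableEq d] in
/-- Joint smoothness on all of `ℝ` is smoothness of the space–time lift. [folklore] -/
private theorem isSmoothSpaceTimeOn_univ_iff {u : ℝ → UnitAddTorus d → F} :
    IsSmoothSpaceTimeOn univ u ↔ ContDiff ℝ ∞ (stLift u) := by
  rw [IsSmoothSpaceTimeOn, univ_prod_univ, contDiffOn_univ]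

omit [DecidableEq d] in
/-- Time reversal preserves joint smoothness on all of `ℝ`. [folklore] -/
private theorem IsSmoothSpaceTimeOn.comp_neg_time {u : ℝ → UnitAddTorus d → F} (hu : IsSmoothSpaceTimeOn univ u) :
    IsSmoothSpaceTimeOn univ (fun s y => u (-s) y) := by
  rw [isSmoothSpaceTimeOn_univ_iff] at hu ⊢
  have h : stLift (fun s y => u (-s) y) = stLift u ∘ fun p : ℝ × EuclideanSpace ℝ d => (-p.1, p.2) := rfl
  rw [h]
  exact hu.comp (contDiff_fst.neg.prodMk contDiff_snd)

omit [Fintype d] [DecidableEq d] in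
/-- `((−u)·∇) v = −(u·∇) v`. [folklore] -/
private theorem convect_neg_left (u : UnitAddTorus d → EuclideanSpace ℝ d) (v : UnitAddTorus d → F) (x : UnitAddTorus d) :
    convect (fun y => -u y) v x = -convect u v x := by
  simp [convect]

/-- Components of the convective derivative: `((u·∇)v)ᵢ = (u·∇)vᵢ` for `C¹` vector fields `v`. [folklore] -/
private theorem convect_apply_coord (u : UnitAddTorus d → EuclideanSpace ℝ d) {v : UnitAddTorus d → EuclideanSpace ℝ d}
    (hv : IsContDiff 1 v) (x : UnitAddTorus d) (i : d) :
    convect u v x i = convect u (fun y => v y i) x := by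
  have hvi : IsContDiff 1 (fun y => v y i) := (EuclideanSpace.proj i : EuclideanSpace ℝ d →L[ℝ] ℝ).contDiff.comp hv
  rw [convect_eq_sum_smul_partialDeriv hv, convect_eq_sum_smul_partialDeriv hvi]
  simp only [WithLp.ofLp_sum, Finset.sum_apply, smul_eq_mul, WithLp.ofLp_smul, Pi.smul_apply]
  refine Finset.sum_congr rfl fun j _ => ?_
  rw [partialDeriv_apply_coord hv]

/-- **Forward times.** The corrected Lemma 7.7 for `0 ≤ t ≤ T = 1/(4 d C_f R_f)`, in the vocabulary of
`TorusAnalyticComposition` (fields jointly smooth on all of `ℝ`, the transport equation pointwise as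
`HasDerivAt`, vector-valued `Y` estimated componentwise, hypotheses with Euclidean norms).
[cite: ArmstrongVicol2025, App. A Lemma 7.7 (p. 72; radius corrected)] -/
theorem dnorm_transportShift_le_of_nonneg (N : ℕ) (f g Y : ℝ → UnitAddTorus d → EuclideanSpace ℝ d)
    (Cf Rf Cg Rg : ℝ) (hCf : 0 < Cf) (hRf : 0 < Rf) (hCg : 0 < Cg) (hRg : 0 < Rg) (hRfg : Rf ≤ Rg)
    (hf : IsSmoothSpaceTimeOn univ f) (hg : IsSmoothSpaceTimeOn univ g) (hY : IsSmoothSpaceTimeOn univ Y)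
    (hY0 : ∀ x, Y 0 x = 0)
    (hODE : ∀ t x, HasDerivAt (fun s => Y s x) (g t x - convect (f t) (Y t) x) t)
    (hfb : ∀ n, 1 ≤ n → n ≤ N → ∀ t, dnorm n Rf (f t) ≤ Cf)
    (hgb : ∀ n, 1 ≤ n → n ≤ N → ∀ t, dnorm n Rg (g t) ≤ Cg)
    {n : ℕ} (hn : 1 ≤ n) (hnN : n ≤ N) {t : ℝ} (ht0 : 0 ≤ t)
    (htT : t ≤ 1 / (4 * (Fintype.card d : ℝ) * Cf * Rf)) (i : d) :
    dnorm n (Rg * (1 + 4 * t * (Fintype.card d : ℝ) * Cf * Rf)) (fun y => Y t y i) ≤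
      8 * (Fintype.card d : ℝ) * Cg * t := by
  have hdd1 : (1 : ℝ) ≤ (Fintype.card d : ℝ) := by
    have : 1 ≤ Fintype.card d := Fintype.card_pos_iff.2 ⟨i⟩
    exact_mod_cast this
  obtain ⟨T, hT⟩ : ∃ T : ℝ, T = 1 / (4 * (Fintype.card d : ℝ) * Cf * Rf) := ⟨_, rfl⟩
  rw [← hT] at htT
  have hTpos : 0 < T := by rw [hT]; positivity
  have hTT : T * (4 * (Fintype.card d : ℝ) * Cf * Rf) ≤ 1 := by
    rw [hT]
    have : (0 : ℝ) < 4 * (Fintype.card d : ℝ) * Cf * Rf := by positivity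
    rw [div_mul_cancel₀ 1 this.ne']
  -- the component fields on the slab `[0,T]`
  have hYi : IsSmoothSpaceTimeOn (Icc 0 T) (fun s y => Y s y i) := (hY.apply i).mono (subset_univ _)
  have hgi : IsSmoothSpaceTimeOn (Icc 0 T) (fun s y => g s y i) := (hg.apply i).mono (subset_univ _)
  have hfT : IsSmoothSpaceTimeOn (Icc 0 T) f := hf.mono (subset_univ _)
  have hODEi : ∀ s x, HasDerivAt (fun τ => Y τ x i) (g s x i - convect (f s) (fun y => Y s y i) x) s := by
    intro s x
    have h := ((EuclideanSpace.proj i : EuclideanSpace ℝ d →L[ℝ] ℝ).hasFDerivAt).comp_hasDerivAt s (hODE s x)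
    have h1 : IsContDiff 1 (Y s) := ((hY.isSmooth_slice (mem_univ s)).isContDiff (by simp))
    have e : (EuclideanSpace.proj i : EuclideanSpace ℝ d →L[ℝ] ℝ) (g s x - convect (f s) (Y s) x) =
        g s x i - convect (f s) (fun y => Y s y i) x := by
      rw [map_sub]
      simp only [PiLp.proj_apply]
      rw [convect_apply_coord (f s) h1 x i]
    rw [e] at h
    exact h
  have heq : ∀ s ∈ Icc 0 T, ∀ x, timeDerivWithin (Icc 0 T) (fun s y => Y s y i) s x +
      convect (f s) (fun y => Y s y i) x = g s x i := by
    intro s hs x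
    rw [timeDerivWithin_eq_of_hasDerivAt hTpos hODEi hs x]
    ring
  have hgbi : ∀ m, 1 ≤ m → m ≤ N → ∀ s ∈ Icc 0 T, dnorm m Rg (fun y => g s y i) ≤ Cg := fun m hm1 hmN s _ =>
    (dnorm_apply_le m hRg.le (hg.isSmooth_slice (mem_univ s)) i).trans (hgb m hm1 hmN s)
  exact dnorm_transport_le_slab hfT hYi hgi (fun x => by simp [hY0 x]) heq le_rfl hdd1 hCf hRf hCg hRg hRfg hTT
    (fun m hm1 hmN s _ => hfb m hm1 hmN s) hgbi hn hnN ⟨ht0, htT⟩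

/-- **Armstrong–Vicol, App. A Lemma 7.7 (transport: regularity shift) with the corrected radius, PROVED.**
For smooth `f, g, Y : ℝ × T^d → ℝ^d` with `(∂ₜ + f·∇)Y = g`, `Y(0,·) = 0`, and
`⟦f(t)⟧_{n,R_f} ≤ C_f`, `⟦g(t)⟧_{n,R_g} ≤ C_g` for `1 ≤ n ≤ N` and all `t`, `R_f ≤ R_g`:
for `1 ≤ n ≤ N`, `|t| ≤ T = 1/(4 d C_f R_f)` and every component `i`,

  `⟦Yᵢ(t)⟧_{n, R_g (1 + 4|t| d C_f R_f)} ≤ 8 d C_g |t|`.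

This is the statement of the tree's named fact `Torus.ArmstrongVicol2025_transportShift` with the
printed radius `R_g + 4|t| d C_f R_f²` replaced by `R_g (1 + 4|t| d C_f R_f) = R_g + 4|t| d C_f R_f R_g`
(equal when `R_g = R_f`; the printed statement is false for `R_g ≫ R_f`, see the file header); it
implies Cor. 7.8 (`ArmstrongVicol2025_transportShift_grad`) as printed. Negative times by time reversal
`s ↦ −s`, `(f, g) ↦ (−f(−s), −g(−s))`.
[cite: ArmstrongVicol2025, App. A Lemma 7.7 (arXiv §7.2 p. 72, (e.transport), (e.bear.salmon.1)–(e.bear.salmon.2)); radius corrected] -/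
theorem dnorm_transportShift_le (N : ℕ) (f g Y : ℝ → UnitAddTorus d → EuclideanSpace ℝ d)
    (Cf Rf Cg Rg : ℝ) (hCf : 0 < Cf) (hRf : 0 < Rf) (hCg : 0 < Cg) (hRg : 0 < Rg) (hRfg : Rf ≤ Rg)
    (hf : IsSmoothSpaceTimeOn univ f) (hg : IsSmoothSpaceTimeOn univ g) (hY : IsSmoothSpaceTimeOn univ Y)
    (hY0 : ∀ x, Y 0 x = 0)
    (hODE : ∀ t x, HasDerivAt (fun s => Y s x) (g t x - convect (f t) (Y t) x) t)
    (hfb : ∀ n, 1 ≤ n → n ≤ N → ∀ t, dnorm n Rf (f t) ≤ Cf)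
    (hgb : ∀ n, 1 ≤ n → n ≤ N → ∀ t, dnorm n Rg (g t) ≤ Cg) :
    ∀ n, 1 ≤ n → n ≤ N → ∀ t : ℝ, |t| ≤ 1 / (4 * (Fintype.card d : ℝ) * Cf * Rf) →
      ∀ i : d, dnorm n (Rg * (1 + 4 * |t| * (Fintype.card d : ℝ) * Cf * Rf)) (fun y => Y t y i) ≤
        8 * (Fintype.card d : ℝ) * Cg * |t| := by
  intro n hn hnN t ht i
  rcases le_or_gt 0 t with ht0 | htneg
  · rw [abs_of_nonneg ht0] at ht ⊢
    exact dnorm_transportShift_le_of_nonneg N f g Y Cf Rf Cg Rg hCf hRf hCg hRg hRfg hf hg hY hY0 hODE hfb hgb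
      hn hnN ht0 ht i
  · -- time reversal
    rw [abs_of_neg htneg] at ht ⊢
    have hfr : IsSmoothSpaceTimeOn univ (fun s y => -f (-s) y) := hf.comp_neg_time.neg
    have hgr : IsSmoothSpaceTimeOn univ (fun s y => -g (-s) y) := hg.comp_neg_time.neg
    have hYr : IsSmoothSpaceTimeOn univ (fun s y => Y (-s) y) := hY.comp_neg_time
    have hODEr : ∀ s x, HasDerivAt (fun τ => Y (-τ) x)
        (-g (-s) x - convect (fun y => -f (-s) y) (fun y => Y (-s) y) x) s := by
      intro s x
      have h := (hODE (-s) x).scomp s (hasDerivAt_neg s)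
      have e : (-1 : ℝ) • (g (-s) x - convect (f (-s)) (Y (-s)) x) =
          -g (-s) x - convect (fun y => -f (-s) y) (fun y => Y (-s) y) x := by
        rw [convect_neg_left, neg_one_smul]
        abel
      rw [e] at h
      exact h
    have hfbr : ∀ n, 1 ≤ n → n ≤ N → ∀ s, dnorm n Rf (fun y => -f (-s) y) ≤ Cf := fun n hn hnN s => by
      rw [dnorm_neg]; exact hfb n hn hnN (-s)
    have hgbr : ∀ n, 1 ≤ n → n ≤ N → ∀ s, dnorm n Rg (fun y => -g (-s) y) ≤ Cg := fun n hn hnN s => by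
      rw [dnorm_neg]; exact hgb n hn hnN (-s)
    have h := dnorm_transportShift_le_of_nonneg N (fun s y => -f (-s) y) (fun s y => -g (-s) y)
      (fun s y => Y (-s) y) Cf Rf Cg Rg hCf hRf hCg hRg hRfg hfr hgr hYr (fun x => by simp [hY0 x]) hODEr
      hfbr hgbr hn hnN (neg_nonneg.2 htneg.le) ht i
    simpa using h

end Packaging

end Torus

end Literature.Analysis.FunctionSpaces

end
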